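import Literature.Claims.NS.ClayVariants
import Literature.Analysis.FluidPDE.NSVorticityBKM
import Literature.Analysis.FluidPDE.NSVorticityBKMEnergy
import Literature.Analysis.FluidPDE.NSVorticityBKMProofs
import Literature.Analysis.FluidPDE.NSVorticityBKMMaximal
import Literature.Analysis.FluidPDE.ClassicalSobolevUniqueness
import Literature.Analysis.FluidPDE.WholeSpaceGagliardoNirenbergSup
import Literature.Analysis.Calculus.IteratedFDerivSymmetric
import Mathlib.Data.Fin.Tuple.Sort
import HarnessLib

/-!
# Claim skeleton (D-0090 NS-CLAIMS, C17): Chae, arXiv:0711.2453v1 (2007, withdrawn the next day) — «Global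
# regularity for the 3D Navier–Stokes and the 3D Euler equations» for `H³(ℝ³)` data

Typed skeleton of D. Chae, *Global regularity for the 3D Navier-Stokes and the 3D Euler equations*,
arXiv:0711.2453 **v1** [math.AP], 15 Nov 2007, 9 pp. (text of record; bib `Chae2007GlobalRegularityWithdrawn`;
TeX source + page renders held in `run/shared/lean/pub/ns-claims/sources/Chae2007/`). Version v2 (16 Nov 2007)
is the author's withdrawal notice, verbatim: "The article … is withdrawn due to a serious error in the proof."
(no locator given). UNREFEREED, WITHDRAWN CLAIM under adjudication — NOTHING in this file asserts a step: the
paper's statements are `def … : Prop`; the only theorems are kernel relations (composition, Clay link, and one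
instantiation lemma). Page numbers `p. N` are the v1 PDF pages; `(1.n)` are the printed equation numbers,
TeX labels in brackets. (NB the bib key `Chae2007` in `references.bib` is the author's UNRELATED Math. Ann. 338
(2007) paper; do not cite it for this claim.)

## The claimed statement (p. 2, Theorem 1.1, verbatim)

"Given `v ∈ H³(ℝ³)` [sic, = `v₀`; p. 1: `H^m(ℝ³)` denotes the Sobolev space of DIVERGENCE-FREE vector fields],
there exists unique global in time classical solution `v ∈ C([0, ∞); H³(ℝ³))` to the system `(NS)_ν` for all
`ν ≥ 0`." — `(NS)_ν` (p. 1): `∂ₜv + (v·∇)v = −∇p + νΔv`, `div v = 0` on `ℝ³ × (0,∞)`, `v(x,0) = v₀(x)`, `ν ≥ 0`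
("Euler equations for `ν = 0`"), no force. "Remark after the proof" (p. 7): the same proof is claimed for the
fractional dissipation `−ν(−Δ)^α v` and for SQG — not typed.

RENDERING (tree convention for this author's class `C([0,T); H^m)`, cf. `ChaeGeneralizedSelfSimilar.lean` and the
BKM file `NSVorticity.lean`): data = smooth divergence-free fields with every derivative in `L²` (`IsDatum`, the
`H^∞ ∩ C^∞` sub-class of the printed `H³(ℝ³)`; it contains all Clay data (4)); "classical solution in
`C([0,T); H³)`" = classical solution in the Beale–Kato–Majda class (`IsLocalSolution`: `IsClassicalNSSolutionOn
(Ico 0 T) ν 0 u p`, `u 0 = v₀`, all `L²` Sobolev norms bounded on every `[0,T'']`, `T'' < T`); "blows up at `T`"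
(p. 2: `limsup_{t→T} ‖v(t)‖_{H^m} = ∞`) = the squared `H³` norm is unbounded on `[0,T)` (`BlowsUpAt`, the negation
of the conclusion of the tree's `MajdaBertozzi2002_bkmAprioriH3`). TODO(general form): `H³` data and Kato's
`C([0,T); H³)` solutions (the tree has no `H³`-strong solution theory on `ℝ³`); every step of the printed proof is
a regularity-blind a priori inequality, so the rendering does not move the locator.

## Clay delta (reference `Literature.Claims.NS.ClayVariants`)

Nearest Clay statement: (A) for the Navier–Stokes conjunct `ClaimedTheoremNS` (`ν > 0`). Δ1 domain `ℝ³` =;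
Δ3 force `f ≡ 0` =; Δ4 data: `H³ ⊋` Clay (4) (Schwartz ⇒ `H^∞`: tree
`HasRapidSpatialDecay.lintegral_enorm_iteratedFDeriv_sq_lt_top`) — the claim admits MORE data, STRONGER; Δ5
solution class: classical `C^∞` with all Sobolev norms bounded on compact time intervals — (6) holds, and the
energy bound (7) follows in the class from the tree's energy inequality `IsClassicalNSSolutionOn.bkm_energy_le`
(Majda–Bertozzi Prop. 3.1, `ν ≥ 0`), so `clay_of_claimedNS : ClaimedTheoremNS → ClayVariants.clayR3.Regularity`
is PROVED below (no delta of substance; no «wrong problem» axis); Δ7: every `ν > 0` =, horizon `[0,∞)` =. The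
Euler conjunct `ClaimedTheoremEuler` (`ν = 0`) is Δ2 OTHER ("not on the Clay Institute's list", Fefferman p. 2),
typed as its own Prop and independently testable (`claimedTheorem_iff`).

## ORDERED STEP INDEX (dependency order = the order `claim_of_steps` consumes them)

Proof by contradiction (p. 2): "Let `T` be the maximal time of existence … suppose `T < ∞` … thanks to the
Beale–Kato–Majda criterion, it suffices to prove `∫₀ᵀ ‖ω(τ)‖_{L^∞} dτ ≤ C(T, v₀) < ∞`".
* `Step_1` (p. 2, citing Kato [kat] = J. Funct. Anal. 9 (1972)): local well-posedness in `H^m`, `m > 5/2`, with a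
  maximal time `T ∈ (0,∞]`; blow-up at a finite maximal time — rendered as the dichotomy GLOBAL solution ∨ finite
  `T` with a solution on `[0,T)` that blows up at `T`. Classical + cite.
* `Step_2` (p. 2 and p. 7, citing Beale–Kato–Majda [bea]): `∫₀ᵀ‖ω‖_∞ < ∞ ⇒ limsup_{t→T}‖v(t)‖_{H³} < ∞`. This IS
  the tree's named fact `Literature.Analysis.FluidPDE.MajdaBertozzi2002_bkmAprioriH3` (DISCHARGED in the tree:
  `MajdaBertozzi2002_bkmAprioriH3_holds`, `NSVorticityBKMHolds.lean`), reused by name.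
* `Step_3` (p. 4, (1.8)): kinetic energy non-increase `‖V(s)‖_{L²} ≤ ‖V₀‖_{L²}`, typed in the original clock
  (`‖V(s(t))‖_{L²} = ‖v(t)‖_{L²}` exactly under (1.1)–(1.4)); in substance the tree's
  `IsClassicalNSSolutionOn.bkm_energy_le`.
* `Step_4` (pp. 3–4: the rescaling (1.1)–(1.4) [2.4–2.6a], the transformed system (1.5)–(1.7) [fir, sec, thir],
  the `Ḣ³` inequality (1.9) [est1] with the Klainerman–Majda commutator estimate [kla] and the
  Gagliardo–Nirenberg inequality (1.10) [gag], ⇒ the displayed differential inequality (p. 4, after (1.10))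
  `d/ds ‖D³V‖_{L²} ≤ −(6γ/5 − C₀‖V₀‖_{L²}^{1/6}) ‖D³V‖_{L²}^{11/6}` on `[0,S)`, `C₀` "an absolute constant",
  `γ > 0` a free parameter): typed as the existence of the function `Z = (s ↦ ‖D³V(s)‖_{L²})` of the new time
  `s`, identified with `v` through the exact scaling identity `‖D³V(s(t))‖ = exp(−(6γ/5)∫₀ᵗ‖D³v‖^{5/6})‖D³v(t)‖`,
  obeying the displayed inequality on `[0,S) = ⋃_{t₁<T} [0, s(t₁))`. ((1.5) prints the viscous term with the sign
  `+νΔV` on the right-hand side; the energy identities (1.8)/(1.9) use the dissipative sign — a typo, immaterial,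
  absent for Euler.)
* `Step_5` (p. 5, (1.11) [sol1]: "which can be solved to provide us with
  `‖D³V(s)‖ ≤ ‖D³V₀‖ / [1 + (6γ/5 − C₀‖V₀‖^{1/6})‖D³V₀‖^{5/6} s]^{6/5}` for all `s ∈ [0,S)`"): typed at the
  ABSTRACT ODE GRAIN (FAILURE-MODES F15; the printed justification is the integration of the differential
  inequality and nothing else): every nonnegative differentiable `Z` on `[0,S)` with `Z′ ≤ −cZ^{11/6}`, `c > 0`
  ((1.12), imposed on p. 5 "from now on"), satisfies the printed bound with the printed constant `c`. (Integrating
  honestly gives the constant `(5/6)c`: `d/ds Z^{−5/6} = −(5/6)Z^{−11/6}Z′`.) `Step_5_pos` is the same sentence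
  with `Z > 0` (the shape pre-agreed on the cell bus by refuter-6 / ref-2); `step_5_pos_of_step_5` is proved.
* `Step_6` (pp. 5–6: "Transforming back to the original velocity … (1.11) can be written as" [display p. 5] ⇒
  (1.13) [log] ⇒ (1.14) [diff]): `∫₀ᵗ‖D³v‖^{5/6} ≤ c⁻¹ log y(t)`,
  `y(t) := 1 + c‖D³v₀‖^{5/6}∫₀ᵗ exp[γ∫₀^τ‖D³v‖^{5/6}]dτ`.
* `Step_7` (p. 6, (1.15) [diffeq1] with `K := γ/c` (1.16) [diffeq2]): `y′ ≤ c‖D³v₀‖^{5/6} y^K` (and the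
  bookkeeping `y(0) = 1`, `y ≥ 1`, `y` continuous, used on p. 6).
* `Step_8` (p. 6, (1.17) [initial] and the sentence "Then the previous condition (1.12) is automatically
  satisfied, and `K < 1`"): pure arithmetic, typed over `ℝ`.
* `Step_9` (p. 6: "Since `y(t) ≥ 1`, the differential inequality (1.15) is reduced to `y′ ≤ c‖D³v₀‖^{5/6} y`,
  which can be solved immediately as (1.18) [y] `y(t) ≤ exp[c‖D³v₀‖^{5/6} t]`"): abstract Grönwall grain.
* `Step_10` (p. 6: "Substituting (1.18) into (1.14), we obtain (1.19) `∫₀ᵗ‖D³v‖^{5/6} ≤ ‖D³v₀‖^{5/6} t` for all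
  `t ∈ [0,T)`"): arithmetic grain.
* `Step_11` (p. 7: (1.19) + (1.10) + (1.8) ⇒ `∫₀ᵀ‖ω‖_∞ ≤ ∫₀ᵀ‖∇v‖_∞ ≤ C∫₀ᵀ‖v‖^{1/6}‖D³v‖^{5/6} ≤
  C‖v₀‖^{1/6}‖D³v₀‖^{5/6} T < ∞`).
* HEADLINE `ClaimedTheorem` (= `ClaimedTheoremNS ∧ ClaimedTheoremEuler`, `claimedTheorem_iff`).

COMPOSITION: proved as `claim_of_steps : Step_1 → … → Step_11 → ClaimedTheorem` (pure logic plus the choice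
`γ := 5(C₀‖v₀‖^{1/6} + 1)` the paper makes at (1.17); the uniqueness half of the headline, which the paper takes
from Kato's local theory [kat], is supplied by the tree's discharged uniqueness theorem in the BKM class,
`IsClassicalNSSolutionOn.eq_of_hasBoundedSobolevNormsOn` (Majda–Bertozzi Cor. 3.1, `ν ≥ 0`)). The skeleton
composes AS PRINTED; the cell's pre-registered locator is `Step_5` = (1.11) p. 5 (lit-1 LOCATORS §3, refuter-6
R-PREDICTION, ref-2 RETYPE v0): with the honestly integrated constant `(5/6)c` the exponent of `Step_7` becomes
`K′ = γ/((5/6)c) = γ/(γ − (5/6)C₀‖v₀‖^{1/6}) > 1` for every `v₀ ≠ 0` and every `γ`, and the sentence of `Step_8`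
fails — recorded here, adjudicated by the refuter/referee, not asserted.

WHAT THIS IS NOT: not a claim about NS regularity or blow-up; not a claim about any author beyond the typed
locator.
-/

noncomputable section

open Set Function Filter MeasureTheory
open scoped Topology ENNReal NNReal ContDiff

namespace Literature.Claims.NS.Chae2007

open Literature.Analysis.FluidPDE

/-! ### Vocabulary of the paper (pp. 1–3, 6) -/

/-- `‖f‖_{L²} = (∫_{ℝ³} |f|² dx)^{1/2}` (p. 1), as a real number: square root of the (real part of the) lower
Lebesgue integral. In the solution class below the integral is finite, so no junk value is met.
[cite: Chae2007GlobalRegularityWithdrawn, §1 p.1] -/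
def l2Norm (f : EuclideanSpace ℝ (Fin 3) → EuclideanSpace ℝ (Fin 3)) : ℝ :=
  Real.sqrt ((∫⁻ x, ‖f x‖ₑ ^ 2).toReal)

/-- The standard basis vector `eᵢ` of `ℝ³` (for the partial derivatives `D^α`, p. 1). [folklore] -/
def basisVec (i : Fin 3) : EuclideanSpace ℝ (Fin 3) :=
  EuclideanSpace.single i 1

/-- `Σ_{|α|=3} |D^α f(x)|²` (p. 1, the integrand of `‖f‖²_{Ḣ³}` with "the standard multi-index notation"): the
sum over multi-indices `α` of order three, written as the sum over SORTED index triples `i ≤ j ≤ k` of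
`|∂ᵢ∂ⱼ∂ₖ f(x)|²`, where `∂ᵢ∂ⱼ∂ₖ f(x) = D³f(x)(eᵢ, eⱼ, eₖ)` (symmetric for `C³` fields).
[cite: Chae2007GlobalRegularityWithdrawn, §1 p.1] -/
def hd3Sq (f : EuclideanSpace ℝ (Fin 3) → EuclideanSpace ℝ (Fin 3)) (x : EuclideanSpace ℝ (Fin 3)) : ℝ :=
  ∑ i : Fin 3, ∑ j : Fin 3, ∑ k : Fin 3,
    if i ≤ j ∧ j ≤ k then ‖iteratedFDeriv ℝ 3 f x ![basisVec i, basisVec j, basisVec k]‖ ^ 2 else 0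

/-- `‖f‖_{Ḣ³} = ‖D³f‖_{L²} := (Σ_{|α|=3} ∫_{ℝ³} |D^α f(x)|² dx)^{1/2}` (p. 1), as a real number.
[cite: Chae2007GlobalRegularityWithdrawn, §1 p.1] -/
def hd3Norm (f : EuclideanSpace ℝ (Fin 3) → EuclideanSpace ℝ (Fin 3)) : ℝ :=
  Real.sqrt ((∫⁻ x, ENNReal.ofReal (hd3Sq f x)).toReal)

/-- `0 ≤ ‖f‖_{L²}` (plumbing). [folklore] -/
private theorem l2Norm_nonneg (f : EuclideanSpace ℝ (Fin 3) → EuclideanSpace ℝ (Fin 3)) : 0 ≤ l2Norm f :=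
  Real.sqrt_nonneg _

/-- `0 ≤ ‖D³f‖_{L²}` (plumbing). [folklore] -/
private theorem hd3Norm_nonneg (f : EuclideanSpace ℝ (Fin 3) → EuclideanSpace ℝ (Fin 3)) : 0 ≤ hd3Norm f :=
  Real.sqrt_nonneg _

/-- The DATA CLASS of Theorem 1.1 (p. 2: "`v₀ ∈ H³(ℝ³)`", p. 1: "`H^m(ℝ³)` … the standard Sobolev space of
divergence free vector fields"), RENDERED in the tree's convention for this class (the `H^∞ ∩ C^∞` data of
`MajdaBertozzi2002_localExistenceH3`): smooth, divergence free, every derivative in `L²(ℝ³)`. It contains every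
Clay datum (4) (`HasRapidSpatialDecay.lintegral_enorm_iteratedFDeriv_sq_lt_top`). TODO(general form): `v₀ ∈ H³`
only. [cite: Chae2007GlobalRegularityWithdrawn, Theorem 1.1 p.2] -/
def IsDatum (v₀ : EuclideanSpace ℝ (Fin 3) → EuclideanSpace ℝ (Fin 3)) : Prop :=
  ContDiff ℝ ∞ v₀ ∧ VectorCalculus.IsDivFree v₀ ∧ ∀ n : ℕ, ∫⁻ x, ‖iteratedFDeriv ℝ n v₀ x‖ₑ ^ 2 < ⊤

/-- "Classical solution `v ∈ C([0,T); H³(ℝ³))` of `(NS)_ν` with `v(x,0) = v₀(x)`" on `[0,T)` (pp. 1–2; Kato's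
class), RENDERED in the Beale–Kato–Majda class of the tree (`NSVorticity.lean`, the class of `beale_kato_majda`):
a classical unforced solution with viscosity `ν` on `ℝ³ × [0,T)`, initial slice `v₀`, all `L²` Sobolev norms of
`u` bounded on every `[0,T'']`, `T'' < T`. [cite: Chae2007GlobalRegularityWithdrawn, §1 pp.1–2] -/
structure IsLocalSolution (ν T : ℝ) (v₀ : EuclideanSpace ℝ (Fin 3) → EuclideanSpace ℝ (Fin 3))
    (u : ℝ → EuclideanSpace ℝ (Fin 3) → EuclideanSpace ℝ (Fin 3)) (p : ℝ → EuclideanSpace ℝ (Fin 3) → ℝ) :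
    Prop where
  /-- `(NS)_ν` (p. 1) holds classically on `ℝ³ × [0,T)`, `u`, `p` jointly smooth. -/
  isClassical : IsClassicalNSSolutionOn (Ico 0 T) ν 0 u p
  /-- `v(x,0) = v₀(x)` (p. 1). -/
  initial : u 0 = v₀
  /-- `v ∈ C([0,T); H^m)` rendered: all Sobolev norms bounded on compact sub-intervals. -/
  sobolev : ∀ T'' < T, HasBoundedSobolevNormsOn (Icc 0 T'') u

/-- "Global in time classical solution `v ∈ C([0,∞); H³(ℝ³))`" (Theorem 1.1, p. 2), RENDERED in the BKM class:
classical unforced solution on `ℝ³ × [0,∞)` from `v₀` with all `L²` Sobolev norms bounded on every `[0,T'']`.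
[cite: Chae2007GlobalRegularityWithdrawn, Theorem 1.1 p.2] -/
structure IsGlobalSolution (ν : ℝ) (v₀ : EuclideanSpace ℝ (Fin 3) → EuclideanSpace ℝ (Fin 3))
    (u : ℝ → EuclideanSpace ℝ (Fin 3) → EuclideanSpace ℝ (Fin 3)) (p : ℝ → EuclideanSpace ℝ (Fin 3) → ℝ) :
    Prop where
  /-- `(NS)_ν` holds classically on `ℝ³ × [0,∞)`. -/
  isClassical : IsClassicalNSSolutionOn (Ici 0) ν 0 u p
  /-- `v(x,0) = v₀(x)`. -/
  initial : u 0 = v₀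
  /-- all Sobolev norms bounded on every `[0,T'']`. -/
  sobolev : ∀ T'' : ℝ, HasBoundedSobolevNormsOn (Icc 0 T'') u

/-- "blows up at `T`": `limsup_{t→T} ‖v(t)‖_{H^m} = ∞` (p. 2), RENDERED for `m = 3`: the squared `H³` norm
`Σ_{n≤3} ∫‖Dⁿu(t)‖²` is NOT bounded on `[0,T)` — verbatim the negation of the conclusion of the tree's
`MajdaBertozzi2002_bkmAprioriH3` (for a solution bounded on compact sub-intervals this is `limsup = ∞`).
[cite: Chae2007GlobalRegularityWithdrawn, §1 p.2] -/
def BlowsUpAt (T : ℝ) (u : ℝ → EuclideanSpace ℝ (Fin 3) → EuclideanSpace ℝ (Fin 3)) : Prop :=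
  ¬ ∃ A : ℝ≥0, ∀ t ∈ Ico 0 T, (∑ n ∈ Finset.range 4, ∫⁻ x, ‖iteratedFDeriv ℝ n (u t) x‖ₑ ^ 2) ≤ (A : ℝ≥0∞)

/-- The exponent of the rescaling (1.1)–(1.4) [2.4–2.6a] (p. 3): `a(t) := ∫₀ᵗ ‖D³v(τ)‖_{L²}^{5/6} dτ`, also the
left-hand side of (1.14)/(1.19); an interval integral (in the class the integrand is bounded and measurable on
`[0,t]`, `t < T`, so no junk value is met). [cite: Chae2007GlobalRegularityWithdrawn, (1.1)–(1.4) p.3] -/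
def expo (u : ℝ → EuclideanSpace ℝ (Fin 3) → EuclideanSpace ℝ (Fin 3)) (t : ℝ) : ℝ :=
  ∫ τ in (0:ℝ)..t, hd3Norm (u τ) ^ ((5:ℝ) / 6)

/-- The new time (1.4) [2.6a] (p. 3): `s(t) := ∫₀ᵗ exp[γ ∫₀^τ ‖D³v(σ)‖_{L²}^{5/6} dσ] dτ` (so `ds = e^{γ a(t)} dt`,
and `S := s(T⁻)` is the new maximal time, p. 3). [cite: Chae2007GlobalRegularityWithdrawn, (1.4) p.3] -/
def clock (γ : ℝ) (u : ℝ → EuclideanSpace ℝ (Fin 3) → EuclideanSpace ℝ (Fin 3)) (t : ℝ) : ℝ :=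
  ∫ τ in (0:ℝ)..t, Real.exp (γ * expo u τ)

/-- `‖D³V(s(t))‖_{L²} = exp(−(6γ/5) a(t)) ‖D³v(t)‖_{L²}` — the `Ḣ³` norm of the rescaled field
`V(y,s) = e^{−(3γ/5)a(t)} v(e^{−(2γ/5)a(t)} y, t)` of (1.1)–(1.3) at the new time `s = s(t)` (exact scaling
identity, `dy = e^{(6γ/5)a(t)} dx`; it is how the paper returns to `v` on p. 5: "using the relations
(1.1)–(1.4)"). [cite: Chae2007GlobalRegularityWithdrawn, (1.1)–(1.4) p.3 and p.5] -/
def hd3Rescaled (γ : ℝ) (u : ℝ → EuclideanSpace ℝ (Fin 3) → EuclideanSpace ℝ (Fin 3)) (t : ℝ) : ℝ :=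
  Real.exp (-(6 * γ / 5) * expo u t) * hd3Norm (u t)

/-- `y(t) := 1 + (6γ/5 − C₀‖v₀‖^{1/6}) ‖D³v₀‖^{5/6} ∫₀ᵗ exp[γ ∫₀^τ ‖D³v(σ)‖^{5/6} dσ] dτ` (p. 6, the display
before (1.15)), with `c` standing for the printed constant `6γ/5 − C₀‖v₀‖_{L²}^{1/6}`.
[cite: Chae2007GlobalRegularityWithdrawn, p.6 (before (1.15))] -/
def yFun (γ c : ℝ) (v₀ : EuclideanSpace ℝ (Fin 3) → EuclideanSpace ℝ (Fin 3))
    (u : ℝ → EuclideanSpace ℝ (Fin 3) → EuclideanSpace ℝ (Fin 3)) (t : ℝ) : ℝ :=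
  1 + c * hd3Norm v₀ ^ ((5:ℝ) / 6) * clock γ u t

/-! ### The claimed theorem (p. 2) -/

/-- Theorem 1.1 AT ONE VISCOSITY `ν` (p. 2), rendered: every datum of the class launches a global classical
solution in the BKM class, and any two such solutions have the same velocity ("there exists unique global in
time classical solution `v ∈ C([0,∞); H³(ℝ³))` to the system `(NS)_ν`").
[claim: Chae2007GlobalRegularityWithdrawn, status: disputed] -/
def GlobalWellposedAt (ν : ℝ) : Prop :=
  ∀ v₀ : EuclideanSpace ℝ (Fin 3) → EuclideanSpace ℝ (Fin 3), IsDatum v₀ →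
    (∃ (u : ℝ → EuclideanSpace ℝ (Fin 3) → EuclideanSpace ℝ (Fin 3)) (p : ℝ → EuclideanSpace ℝ (Fin 3) → ℝ),
      IsGlobalSolution ν v₀ u p) ∧
    ∀ (u : ℝ → EuclideanSpace ℝ (Fin 3) → EuclideanSpace ℝ (Fin 3)) (p : ℝ → EuclideanSpace ℝ (Fin 3) → ℝ)
      (u' : ℝ → EuclideanSpace ℝ (Fin 3) → EuclideanSpace ℝ (Fin 3)) (p' : ℝ → EuclideanSpace ℝ (Fin 3) → ℝ),
      IsGlobalSolution ν v₀ u p → IsGlobalSolution ν v₀ u' p' → ∀ t : ℝ, 0 ≤ t → u' t = u t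

/-- **HEADLINE — Theorem 1.1 (p. 2), as printed**: "Given `v₀ ∈ H³(ℝ³)`, there exists unique global in time
classical solution `v ∈ C([0, ∞); H³(ℝ³))` to the system `(NS)_ν` for all `ν ≥ 0`." (Navier–Stokes for
`ν > 0` AND Euler for `ν = 0`; no force; whole space.) [claim: Chae2007GlobalRegularityWithdrawn, status: disputed] -/
def ClaimedTheorem : Prop :=
  ∀ ν : ℝ, 0 ≤ ν → GlobalWellposedAt ν

/-- The Navier–Stokes conjunct of Theorem 1.1 (`ν > 0`; the (A)-shaped half, see `clay_of_claimedNS`).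
[claim: Chae2007GlobalRegularityWithdrawn, status: disputed] -/
def ClaimedTheoremNS : Prop :=
  ∀ ν : ℝ, 0 < ν → GlobalWellposedAt ν

/-- The Euler conjunct of Theorem 1.1 (`ν = 0`: "Euler equations for `ν = 0`", p. 1; Δ2 OTHER w.r.t. Clay — the
proof is viscosity-independent, so this conjunct carries the same locator and is independently testable).
[claim: Chae2007GlobalRegularityWithdrawn, status: disputed] -/
def ClaimedTheoremEuler : Prop :=
  GlobalWellposedAt 0

/-- Theorem 1.1 is exactly the conjunction of its Navier–Stokes and Euler halves (`ν ≥ 0 ↔ ν > 0 ∨ ν = 0`).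
[cite: Chae2007GlobalRegularityWithdrawn, Theorem 1.1 p.2] -/
theorem claimedTheorem_iff : ClaimedTheorem ↔ ClaimedTheoremNS ∧ ClaimedTheoremEuler := by
  constructor
  · exact fun h => ⟨fun ν hν => h ν hν.le, h 0 le_rfl⟩
  · rintro ⟨hNS, hE⟩ ν hν
    rcases hν.eq_or_lt with h0 | hpos
    · rw [← h0]; exact hE
    · exact hNS ν hpos

/-! ### The paper's steps (no assertion) -/

/-- **Step 1 — the local theory the proof starts from (p. 2, citing Kato [kat], J. Funct. Anal. 9 (1972))**:
"given `v₀ ∈ H^m(ℝ³)`, there exists `T ∈ (0, ∞]` such that there exists unique solution `v ∈ C([0,T); H^m(ℝ³))`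
to `(NS)_ν`", used on p. 2 as "Let `T` be the maximal time of existence of a classical solution … Let us suppose
`T < ∞`" together with the blow-up definition (p. 2: "blows up at `T` if `limsup_{t→T}‖v(t)‖_{H^m} = ∞`").
RENDERED as the dichotomy the argument by contradiction uses, for every `ν ≥ 0` and every datum of the class:
EITHER a global solution in the class exists, OR there are a finite `T > 0` and a solution on `[0,T)` in the
class that blows up at `T` (the maximal solution; finite maximal time ⇒ `H³` blow-up by the local theory).
Classical (Kato 1972; Majda–Bertozzi Thm. 3.4 / Cor. 3.2; tree ingredients `MajdaBertozzi2002_localExistenceH3_holds`,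
`hasSobolevExtensionPast_of_H3_bound_of_parts`); uniqueness in the class is the tree's
`IsClassicalNSSolutionOn.eq_of_hasBoundedSobolevNormsOn`. [cite: Chae2007GlobalRegularityWithdrawn, §1 p.2 (citing Kato 1972)] -/
def Step_1 : Prop :=
  ∀ ν : ℝ, 0 ≤ ν → ∀ v₀ : EuclideanSpace ℝ (Fin 3) → EuclideanSpace ℝ (Fin 3), IsDatum v₀ →
    (∃ (u : ℝ → EuclideanSpace ℝ (Fin 3) → EuclideanSpace ℝ (Fin 3)) (p : ℝ → EuclideanSpace ℝ (Fin 3) → ℝ),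
      IsGlobalSolution ν v₀ u p) ∨
    ∃ T : ℝ, 0 < T ∧
      ∃ (u : ℝ → EuclideanSpace ℝ (Fin 3) → EuclideanSpace ℝ (Fin 3)) (p : ℝ → EuclideanSpace ℝ (Fin 3) → ℝ),
        IsLocalSolution ν T v₀ u p ∧ BlowsUpAt T u

/-- **Step 2 — the Beale–Kato–Majda criterion as used (p. 2: "the blow-up … happens at `T` if and only if
`∫₀ᵀ ‖ω(t)‖_{L^∞} dt = ∞`" [bea]; p. 7: "by the Beale–Kato–Majda criterion, we find
`limsup_{t→T} ‖v(t)‖_{H³} < ∞`")**: for a classical unforced solution on `[0,T)` in the BKM class, `ν ≥ 0`,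
`∫₀ᵀ ‖curl u‖_∞ < ∞` bounds `Σ_{n≤3}∫‖Dⁿu(t)‖²` uniformly on `[0,T)`. This is, BY NAME, the tree's named fact
`Literature.Analysis.FluidPDE.MajdaBertozzi2002_bkmAprioriH3` (Majda–Bertozzi 2002, proof of Thm. 3.6), which is
DISCHARGED in the tree (`MajdaBertozzi2002_bkmAprioriH3_holds`). [cite: Chae2007GlobalRegularityWithdrawn, §1 p.2 and p.7 (citing Beale–Kato–Majda 1984)] -/
def Step_2 : Prop :=
  Literature.Analysis.FluidPDE.MajdaBertozzi2002_bkmAprioriH3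

/-- **Step 3 — (1.8), p. 4**: "Taking `L²(ℝ³)` inner product of (1.5) with `V`, and integrating by part, we find
`½ d/ds ‖V(s)‖² = −ν‖∇V‖² exp[…] ≤ 0`, which implies the bound of the kinetic energy (1.8)
`‖V(s)‖_{L²} ≤ ‖V₀‖_{L²}`." Typed in the original clock: under (1.1)–(1.4) `‖V(s(t))‖_{L²} = ‖v(t)‖_{L²}`
exactly and `V₀ = v₀` (1.7), so (1.8) reads `‖v(t)‖_{L²} ≤ ‖v₀‖_{L²}` for `t ∈ [0,T)`. (In substance the tree's
energy inequality in the BKM class, `IsClassicalNSSolutionOn.bkm_energy_le`, Majda–Bertozzi Prop. 3.1, `ν ≥ 0`.)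
[claim: Chae2007GlobalRegularityWithdrawn, status: disputed] -/
def Step_3 : Prop :=
  ∀ ν : ℝ, 0 ≤ ν → ∀ T : ℝ, 0 < T →
    ∀ (v₀ : EuclideanSpace ℝ (Fin 3) → EuclideanSpace ℝ (Fin 3))
      (u : ℝ → EuclideanSpace ℝ (Fin 3) → EuclideanSpace ℝ (Fin 3)) (p : ℝ → EuclideanSpace ℝ (Fin 3) → ℝ),
      IsLocalSolution ν T v₀ u p → ∀ t ∈ Ico 0 T, l2Norm (u t) ≤ l2Norm v₀

/-- **Step 4 — pp. 3–4: (1.1)–(1.7), (1.9), (1.10) ⇒ the differential inequality displayed after (1.10)**: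
"Hence, from (1.9), ignoring the viscosity term, we have the differential inequality
`d/ds ‖D³V‖_{L²} ≤ −(6γ/5 − C₀‖V₀‖_{L²}^{1/6}) ‖D³V‖_{L²}^{11/6}`", for "an absolute constant `C₀`" (p. 4, from
the Klainerman–Majda commutator estimate `‖D³(fg) − fD³g‖ ≤ C(‖∇f‖_∞‖D²g‖ + ‖D³f‖‖g‖_∞)` [kla] and the
Gagliardo–Nirenberg inequality (1.10) `‖∇h‖_∞ ≤ C‖h‖^{1/6}_{L²}‖D³h‖^{5/6}_{L²}` — admissible exponents, `θ = 5/6`),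
every `γ > 0` (the parameter is fixed only at (1.17)), using (1.8) (`Step_3`) in the last line of (1.9).
TYPED (quantifier order as printed: `∃ C₀ ∀ γ ∀ solutions`, F11): the function `Z := (s ↦ ‖D³V(s)‖_{L²})` of
the new time exists on `[0,S) = ⋃_{t₁<T}[0, s(t₁))`, is identified with `v` by the exact scaling relation
`Z(s(t)) = e^{−(6γ/5)a(t)}‖D³v(t)‖` ((1.1)–(1.4); `Z(0) = ‖D³v₀‖` by (1.7)), is nonnegative and differentiable,
and satisfies the displayed inequality. (A priori estimate; true in substance modulo the bookkeeping of the
class — refuter-6 / ref-2 / lit-1 re-derived (1.5), (1.9), (1.10) on the TeX.)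
[claim: Chae2007GlobalRegularityWithdrawn, status: disputed] -/
def Step_4 : Prop :=
  ∃ C₀ : ℝ, 0 < C₀ ∧ ∀ γ : ℝ, 0 < γ → ∀ ν : ℝ, 0 ≤ ν → ∀ T : ℝ, 0 < T →
    ∀ (v₀ : EuclideanSpace ℝ (Fin 3) → EuclideanSpace ℝ (Fin 3))
      (u : ℝ → EuclideanSpace ℝ (Fin 3) → EuclideanSpace ℝ (Fin 3)) (p : ℝ → EuclideanSpace ℝ (Fin 3) → ℝ),
      IsLocalSolution ν T v₀ u p → (∀ t ∈ Ico 0 T, l2Norm (u t) ≤ l2Norm v₀) →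
      ∃ Z : ℝ → ℝ, Z 0 = hd3Norm v₀ ∧ (∀ t ∈ Ico 0 T, Z (clock γ u t) = hd3Rescaled γ u t) ∧
        ∀ t₁ ∈ Ico 0 T, ∀ s ∈ Ico 0 (clock γ u t₁),
          0 ≤ Z s ∧ DifferentiableAt ℝ Z s ∧
            deriv Z s ≤ -(6 * γ / 5 - C₀ * l2Norm v₀ ^ ((1:ℝ) / 6)) * Z s ^ ((11:ℝ) / 6)

/-- **Step 5 — (1.11) [sol1], p. 5, at the abstract ODE grain (FAILURE-MODES F15)**: "… the differential
inequality `d/ds ‖D³V‖_{L²} ≤ −(6γ/5 − C₀‖V₀‖^{1/6}) ‖D³V‖^{11/6}_{L²}`, which can be solved to provide us with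
(1.11) `‖D³V(s)‖_{L²} ≤ ‖D³V₀‖_{L²} / [1 + (6γ/5 − C₀‖V₀‖_{L²}^{1/6}) ‖D³V₀‖^{5/6}_{L²} s]^{6/5}` for all
`s ∈ [0, S)`." TYPED as the real-variable lemma the sentence invokes, with `c > 0` for the printed constant
((1.12), p. 5: "From now on we assume the values of `γ` large enough so that `6γ/5 − C₀‖v₀‖^{1/6} > 0`"): every
nonnegative `Z`, differentiable on `[0,S)` with `Z′ ≤ −c Z^{11/6}` there, obeys the printed bound with the
PRINTED constant `c`. (`Z ≥ 0` as for a norm; `Step_5_pos` is the `Z > 0` variant.)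
[claim: Chae2007GlobalRegularityWithdrawn, status: disputed] -/
def Step_5 : Prop :=
  ∀ (c S : ℝ), 0 < c → 0 < S → ∀ Z : ℝ → ℝ,
    (∀ s ∈ Ico (0:ℝ) S, 0 ≤ Z s) →
    (∀ s ∈ Ico (0:ℝ) S, DifferentiableAt ℝ Z s ∧ deriv Z s ≤ -c * Z s ^ ((11:ℝ) / 6)) →
    ∀ s ∈ Ico (0:ℝ) S, Z s ≤ Z 0 / (1 + c * Z 0 ^ ((5:ℝ) / 6) * s) ^ ((6:ℝ) / 5)

/-- **Step 5, positive variant** — the same printed sentence (1.11) p. 5 for POSITIVE `Z` (verbatim the shape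
`ODE_printed` pre-agreed on the cell bus by refuter-6 and ref-2, against which the extremal-solution countermodel
was prepared); `Step_5 → Step_5_pos` (`step_5_pos_of_step_5`), so a refutation of this variant refutes `Step_5`.
[claim: Chae2007GlobalRegularityWithdrawn, status: disputed] -/
def Step_5_pos : Prop :=
  ∀ (c S : ℝ), 0 < c → 0 < S → ∀ Z : ℝ → ℝ,
    (∀ s ∈ Ico (0:ℝ) S, 0 < Z s) →
    (∀ s ∈ Ico (0:ℝ) S, DifferentiableAt ℝ Z s ∧ deriv Z s ≤ -c * Z s ^ ((11:ℝ) / 6)) →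
    ∀ s ∈ Ico (0:ℝ) S, Z s ≤ Z 0 / (1 + c * Z 0 ^ ((5:ℝ) / 6) * s) ^ ((6:ℝ) / 5)

/-- `Step_5` implies its positive-`Z` variant (weakening of a hypothesis); hence `¬ Step_5_pos → ¬ Step_5`.
[cite: Chae2007GlobalRegularityWithdrawn, (1.11) p.5] -/
theorem step_5_pos_of_step_5 (h : Step_5) : Step_5_pos :=
  fun c S hc hS Z hpos hder => h c S hc hS Z (fun s hs => (hpos s hs).le) hder

/-- **Step 6 — pp. 5–6: (1.11) ∧ (1.12) ⇒ (1.13) [log] ⇒ (1.14) [diff]**: "Transforming back to the original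
velocity `v`, using the relations (1.1)–(1.4), we find that (1.11) can be written as
`‖D³v(t)‖ ≤ ‖D³v₀‖ exp[(6γ/5)∫₀ᵗ‖D³v‖^{5/6}] / {1 + c‖D³v₀‖^{5/6}∫₀ᵗ exp[γ∫₀^τ‖D³v‖^{5/6}dσ]dτ}^{6/5}`, from
which we observe that (1.13) `‖D³v(t)‖^{5/6} ≤ … = c⁻¹ d/dt log{1 + c‖D³v₀‖^{5/6}∫₀ᵗ exp[γ∫₀^τ‖D³v‖^{5/6}]dτ}`.
Hence, integrating (1.13) over `[0,t]`, we obtain (1.14)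
`∫₀ᵗ ‖D³v(τ)‖^{5/6} dτ ≤ c⁻¹ log{1 + c‖D³v₀‖^{5/6}∫₀ᵗ exp[γ∫₀^τ‖D³v‖^{5/6}dσ]dτ}`", `c = 6γ/5 − C₀‖v₀‖^{1/6} > 0`
by (1.12). TYPED: for the function `Z` of `Step_4` (identified with `v` by (1.1)–(1.4)), the bound (1.11) on
`[0,S)` implies (1.14), i.e. `a(t) ≤ c⁻¹ log y(t)` for `t ∈ [0,T)`. (Calculus; true given the identification.)
[claim: Chae2007GlobalRegularityWithdrawn, status: disputed] -/
def Step_6 : Prop :=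
  ∀ γ c : ℝ, 0 < γ → 0 < c → ∀ ν : ℝ, 0 ≤ ν → ∀ T : ℝ, 0 < T →
    ∀ (v₀ : EuclideanSpace ℝ (Fin 3) → EuclideanSpace ℝ (Fin 3))
      (u : ℝ → EuclideanSpace ℝ (Fin 3) → EuclideanSpace ℝ (Fin 3)) (p : ℝ → EuclideanSpace ℝ (Fin 3) → ℝ),
      IsLocalSolution ν T v₀ u p →
      ∀ Z : ℝ → ℝ, Z 0 = hd3Norm v₀ → (∀ t ∈ Ico 0 T, Z (clock γ u t) = hd3Rescaled γ u t) →
        (∀ t₁ ∈ Ico 0 T, ∀ s ∈ Ico 0 (clock γ u t₁),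
          Z s ≤ Z 0 / (1 + c * Z 0 ^ ((5:ℝ) / 6) * s) ^ ((6:ℝ) / 5)) →
        ∀ t ∈ Ico 0 T, expo u t ≤ c⁻¹ * Real.log (yFun γ c v₀ u t)

/-- **Step 7 — p. 6, (1.15) [diffeq1] with (1.16) [diffeq2]**: "Now, setting `y(t) := 1 + c‖D³v₀‖^{5/6}
∫₀ᵗ exp[γ∫₀^τ‖D³v‖^{5/6}dσ]dτ`, we find that (1.14) can be rewritten as a differential inequality (1.15)
`y′(t) ≤ c‖D³v₀‖^{5/6} y(t)^K`, where we set (1.16) `K := γ / (6γ/5 − C₀‖v₀‖^{1/6})`" (`= γ/c`). TYPED with the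
bookkeeping the next lines use ("Since `y(t) ≥ 1` …", `y(0) = 1`, continuity of `y`) and the time derivative as
a right derivative on `[0,T)` (`y′(t) = c‖D³v₀‖^{5/6} e^{γ a(t)} ≤ c‖D³v₀‖^{5/6} y^{γ/c}` by (1.14)).
[claim: Chae2007GlobalRegularityWithdrawn, status: disputed] -/
def Step_7 : Prop :=
  ∀ γ c : ℝ, 0 < γ → 0 < c → ∀ ν : ℝ, 0 ≤ ν → ∀ T : ℝ, 0 < T →
    ∀ (v₀ : EuclideanSpace ℝ (Fin 3) → EuclideanSpace ℝ (Fin 3))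
      (u : ℝ → EuclideanSpace ℝ (Fin 3) → EuclideanSpace ℝ (Fin 3)) (p : ℝ → EuclideanSpace ℝ (Fin 3) → ℝ),
      IsLocalSolution ν T v₀ u p →
      (∀ t ∈ Ico 0 T, expo u t ≤ c⁻¹ * Real.log (yFun γ c v₀ u t)) →
      yFun γ c v₀ u 0 = 1 ∧ ContinuousOn (yFun γ c v₀ u) (Ico 0 T) ∧ (∀ t ∈ Ico 0 T, 1 ≤ yFun γ c v₀ u t) ∧
        ∀ t ∈ Ico 0 T, ∃ D : ℝ, HasDerivWithinAt (yFun γ c v₀ u) D (Ici t) t ∧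
          D ≤ c * hd3Norm v₀ ^ ((5:ℝ) / 6) * yFun γ c v₀ u t ^ (γ / c)

/-- **Step 8 — p. 6, (1.17) [initial] and the next sentence**: "We now fix `γ` so that (1.17)
`C₀‖v₀‖_{L²}^{1/6} < γ/5`. Then the previous condition (1.12) is automatically satisfied, and `K < 1`." — pure
arithmetic over `ℝ` with `m = C₀‖v₀‖^{1/6} ≥ 0`, `c = 6γ/5 − m`, `K = γ/c` (1.16). (Correct arithmetic FOR THE
PRINTED constant `c`; with the honestly integrated constant `(5/6)c` of `Step_5` the exponent is
`γ/((5/6)c) ≥ 1`, `> 1` for `m > 0` — the downstream locator recorded by ref-2, not asserted here.)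
[claim: Chae2007GlobalRegularityWithdrawn, status: disputed] -/
def Step_8 : Prop :=
  ∀ γ m : ℝ, 0 < γ → 0 ≤ m → m < γ / 5 → 0 < 6 * γ / 5 - m ∧ γ / (6 * γ / 5 - m) < 1

/-- **Step 9 — p. 6, (1.15) ⇒ (1.18) [y]**: "Since `y(t) ≥ 1`, the differential inequality (1.15) is reduced to
`y′(t) ≤ c‖D³v₀‖^{5/6} y(t)`, which can be solved immediately as (1.18) `y(t) ≤ exp[c‖D³v₀‖^{5/6} t]`." TYPED
at the abstract Grönwall grain: a continuous `y ≥ 1` on `[0,T)` with `y(0) = 1` and right derivative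
`≤ M y^K`, `M ≥ 0`, `K < 1`, satisfies `y(t) ≤ e^{Mt}` (`y^K ≤ y` for `y ≥ 1`, `K ≤ 1`; Grönwall).
[claim: Chae2007GlobalRegularityWithdrawn, status: disputed] -/
def Step_9 : Prop :=
  ∀ (M K T : ℝ), 0 ≤ M → K < 1 → 0 < T → ∀ y : ℝ → ℝ,
    y 0 = 1 → ContinuousOn y (Ico 0 T) → (∀ t ∈ Ico 0 T, 1 ≤ y t) →
    (∀ t ∈ Ico 0 T, ∃ D : ℝ, HasDerivWithinAt y D (Ici t) t ∧ D ≤ M * y t ^ K) →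
    ∀ t ∈ Ico 0 T, y t ≤ Real.exp (M * t)

/-- **Step 10 — p. 6, (1.14) ∧ (1.18) ⇒ (1.19)**: "Substituting (1.18) into (1.14), we obtain that (1.19)
`∫₀ᵗ ‖D³v(τ)‖^{5/6}_{L²} dτ ≤ ‖D³v₀‖^{5/6}_{L²} t` for all `t ∈ [0,T)`." — arithmetic over `ℝ` (`a = a(t)`,
`y = y(t) > 0`, `Z₀ = ‖D³v₀‖`, `c > 0`: `a ≤ c⁻¹ log y` and `y ≤ e^{cZ₀^{5/6}t}` give `a ≤ Z₀^{5/6} t`).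
[claim: Chae2007GlobalRegularityWithdrawn, status: disputed] -/
def Step_10 : Prop :=
  ∀ (c Z₀ a y t : ℝ), 0 < c → 0 ≤ Z₀ → 0 < y →
    a ≤ c⁻¹ * Real.log y → y ≤ Real.exp (c * Z₀ ^ ((5:ℝ) / 6) * t) → a ≤ Z₀ ^ ((5:ℝ) / 6) * t

/-- **Step 11 — p. 7, the BKM quantity**: "This, combined with the Gagliardo–Nirenberg inequality (1.10), provides
us with `∫₀ᵀ ‖ω(t)‖_{L^∞} dτ ≤ ∫₀ᵀ ‖∇v(t)‖_{L^∞} dτ ≤ C ∫₀ᵀ ‖v(τ)‖^{1/6}_{L²}‖D³v(τ)‖^{5/6}_{L²} dτ ≤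
C‖v₀‖^{1/6}_{L²}‖D³v₀‖^{5/6}_{L²} T < ∞`" — from (1.8) (`Step_3`) and (1.19), for an absolute constant `C`
(`∃ C ∀ solutions`). The left-hand side is the tree's BKM integral `∫⁻_{(0,T)} ⨆ₓ ‖curl u(t,x)‖ₑ`
(`beale_kato_majda`, `MajdaBertozzi2002_bkmAprioriH3`), so no `sup`/`∫` junk value enters.
[claim: Chae2007GlobalRegularityWithdrawn, status: disputed] -/
def Step_11 : Prop :=
  ∃ C : ℝ, 0 < C ∧ ∀ ν : ℝ, 0 ≤ ν → ∀ T : ℝ, 0 < T →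
    ∀ (v₀ : EuclideanSpace ℝ (Fin 3) → EuclideanSpace ℝ (Fin 3))
      (u : ℝ → EuclideanSpace ℝ (Fin 3) → EuclideanSpace ℝ (Fin 3)) (p : ℝ → EuclideanSpace ℝ (Fin 3) → ℝ),
      IsLocalSolution ν T v₀ u p → (∀ t ∈ Ico 0 T, l2Norm (u t) ≤ l2Norm v₀) →
      (∀ t ∈ Ico 0 T, expo u t ≤ hd3Norm v₀ ^ ((5:ℝ) / 6) * t) →
      (∫⁻ t in Ioo 0 T, ⨆ x, ‖curl (u t) x‖ₑ) ≤
        ENNReal.ofReal (C * l2Norm v₀ ^ ((1:ℝ) / 6) * hd3Norm v₀ ^ ((5:ℝ) / 6) * T)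

/-! ### Kernel relations: composition (the printed logic composes) and the Clay link -/

/-- **Composition — Steps 1–11 in the printed order give Theorem 1.1.** For `ν ≥ 0` and a datum, `Step_1` gives
a global solution or a finite maximal time `T` with blow-up. In the latter case the a priori chain of pp. 3–7 runs
on the maximal solution: (1.8) (`Step_3`); the constant `C₀` of `Step_4`; the paper's choice (1.17)
`γ := 5(C₀‖v₀‖^{1/6} + 1)`, so `c = 6γ/5 − C₀‖v₀‖^{1/6} > 0` and `K = γ/c < 1` (`Step_8`); the function
`Z = ‖D³V(·)‖` of `Step_4` on each `[0, s(t₁))`; (1.11) by `Step_5`; (1.14) by `Step_6`; (1.15) by `Step_7`;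
(1.18) by `Step_9`; (1.19) by `Step_10`; the bound on `∫₀ᵀ‖ω‖_∞` by `Step_11`; hence `limsup‖v‖_{H³} < ∞` by
`Step_2` (BKM), contradicting the blow-up at `T` — so the first alternative holds: a global solution exists.
Uniqueness (the "unique" of Theorem 1.1, which the paper imports from Kato's local well-posedness [kat], p. 2)
is the tree's discharged `IsClassicalNSSolutionOn.eq_of_hasBoundedSobolevNormsOn` (Majda–Bertozzi Cor. 3.1,
`ν ≥ 0`) on each slab `[0, t+1]`. Pure logic otherwise; nothing is asserted.
[claim: Chae2007GlobalRegularityWithdrawn, status: disputed] -/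
theorem claim_of_steps (h1 : Step_1) (h2 : Step_2) (h3 : Step_3) (h4 : Step_4) (h5 : Step_5) (h6 : Step_6)
    (h7 : Step_7) (h8 : Step_8) (h9 : Step_9) (h10 : Step_10) (h11 : Step_11) : ClaimedTheorem := by
  intro ν hν v₀ hv₀
  refine ⟨?_, ?_⟩
  · -- existence: global, or a finite maximal time refuted by the a priori chain + BKM
    rcases h1 ν hν v₀ hv₀ with hglob | ⟨T, hT, u, p, hsol, hblow⟩
    · exact hglob
    · exfalso
      -- (1.8)
      have hE : ∀ t ∈ Ico 0 T, l2Norm (u t) ≤ l2Norm v₀ := h3 ν hν T hT v₀ u p hsol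
      -- the absolute constant `C₀` of (1.9) and the choice (1.17) of `γ`
      obtain ⟨C₀, hC₀, h4'⟩ := h4
      set m : ℝ := C₀ * l2Norm v₀ ^ ((1:ℝ) / 6) with hm
      have hm0 : 0 ≤ m := mul_nonneg hC₀.le (Real.rpow_nonneg (l2Norm_nonneg v₀) _)
      set γ : ℝ := 5 * (m + 1) with hγ
      have hγ0 : 0 < γ := by rw [hγ]; linarith
      have h17 : m < γ / 5 := by
        have : γ / 5 = m + 1 := by rw [hγ]; ring
        rw [this]; linarith
      -- (1.12) and `K < 1`
      obtain ⟨hc, hK⟩ := h8 γ m hγ0 hm0 h17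
      -- the function `Z = ‖D³V(·)‖` and its differential inequality
      obtain ⟨Z, hZ0, hZid, hZode⟩ := h4' γ hγ0 ν hν T hT v₀ u p hsol hE
      -- (1.11) on every `[0, s(t₁))`
      have h111 : ∀ t₁ ∈ Ico 0 T, ∀ s ∈ Ico 0 (clock γ u t₁),
          Z s ≤ Z 0 / (1 + (6 * γ / 5 - m) * Z 0 ^ ((5:ℝ) / 6) * s) ^ ((6:ℝ) / 5) := by
        intro t₁ ht₁ s hs
        have hS : 0 < clock γ u t₁ := lt_of_le_of_lt hs.1 hs.2
        exact h5 (6 * γ / 5 - m) (clock γ u t₁) hc hS Z (fun s' hs' => (hZode t₁ ht₁ s' hs').1)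
          (fun s' hs' => (hZode t₁ ht₁ s' hs').2) s hs
      -- (1.14)
      have h114 : ∀ t ∈ Ico 0 T, expo u t ≤ (6 * γ / 5 - m)⁻¹ * Real.log (yFun γ (6 * γ / 5 - m) v₀ u t) :=
        h6 γ (6 * γ / 5 - m) hγ0 hc ν hν T hT v₀ u p hsol Z hZ0 hZid h111
      -- (1.15)
      obtain ⟨hy0, hycont, hy1, hyder⟩ := h7 γ (6 * γ / 5 - m) hγ0 hc ν hν T hT v₀ u p hsol h114
      -- (1.18)
      have hM : 0 ≤ (6 * γ / 5 - m) * hd3Norm v₀ ^ ((5:ℝ) / 6) :=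
        mul_nonneg hc.le (Real.rpow_nonneg (hd3Norm_nonneg v₀) _)
      have h118 : ∀ t ∈ Ico 0 T, yFun γ (6 * γ / 5 - m) v₀ u t ≤
          Real.exp ((6 * γ / 5 - m) * hd3Norm v₀ ^ ((5:ℝ) / 6) * t) :=
        h9 ((6 * γ / 5 - m) * hd3Norm v₀ ^ ((5:ℝ) / 6)) (γ / (6 * γ / 5 - m)) T hM hK hT
          (yFun γ (6 * γ / 5 - m) v₀ u) hy0 hycont hy1 hyder
      -- (1.19)
      have h119 : ∀ t ∈ Ico 0 T, expo u t ≤ hd3Norm v₀ ^ ((5:ℝ) / 6) * t := fun t ht =>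
        h10 (6 * γ / 5 - m) (hd3Norm v₀) (expo u t) (yFun γ (6 * γ / 5 - m) v₀ u t) t hc
          (hd3Norm_nonneg v₀) (lt_of_lt_of_le one_pos (hy1 t ht)) (h114 t ht) (h118 t ht)
      -- p. 7: the BKM integral is finite
      obtain ⟨C, -, h11'⟩ := h11
      have hω := h11' ν hν T hT v₀ u p hsol hE h119
      have hfin : (∫⁻ t in Ioo 0 T, ⨆ x, ‖curl (u t) x‖ₑ) < ⊤ := lt_of_le_of_lt hω ENNReal.ofReal_lt_top
      -- BKM: `H³` stays bounded, contradicting the blow-up at the maximal time `T`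
      exact hblow (h2 hν hT hsol.isClassical hsol.sobolev hfin)
  · -- uniqueness in the class (Kato's local theory as cited on p. 2; tree: Majda–Bertozzi Cor. 3.1, ν ≥ 0)
    intro u p u' p' hu hu' t ht
    have hT : (0:ℝ) < t + 1 := by linarith
    have hU : UniqueDiffOn ℝ (Icc (0:ℝ) (t + 1)) := uniqueDiffOn_Icc hT
    have h1c : IsClassicalNSSolutionOn (Icc 0 (t + 1)) ν 0 u p := hu.isClassical.mono Icc_subset_Ici_self hU
    have h2c : IsClassicalNSSolutionOn (Icc 0 (t + 1)) ν 0 u' p' :=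
      hu'.isClassical.mono Icc_subset_Ici_self hU
    have h0 : u' 0 = u 0 := by rw [hu'.initial, hu.initial]
    exact h2c.eq_of_hasBoundedSobolevNormsOn h1c hν hT (hu'.sobolev (t + 1)) (hu.sobolev (t + 1)) h0
      ⟨ht, by linarith⟩

/-- **Clay link: the Navier–Stokes conjunct of Theorem 1.1 implies Clay (A)** (`ClayVariants.clayR3.Regularity`,
token-for-token the summit body): a Clay datum (smooth, divergence free, rapid decay (4)) is a datum of the class
(Schwartz ⇒ `H^∞`, tree `HasRapidSpatialDecay.lintegral_enorm_iteratedFDeriv_sq_lt_top`); the global solution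
of the class is smooth on `ℝ³ × [0,∞)` with `u(0) = u₀` (bridge `isNavierStokesSolution_and_smooth_iff`), and the
energy bound (7) holds with `C = ∫|u₀|²` by the tree's energy inequality in the BKM class
(`IsClassicalNSSolutionOn.bkm_energy_le`, Majda–Bertozzi Prop. 3.1). Δ4/Δ5 of the module docstring; no delta of
substance remains. [cite: FeffermanClay2006, statement (A), CMI offprint p. 2] -/
theorem clay_of_claimedNS (h : ClaimedTheoremNS) : ClayVariants.clayR3.Regularity := by
  intro ν hν u₀ hu₀ hdiv hdecay
  have hdat : IsDatum u₀ :=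
    ⟨hu₀, fun x => hdiv x, fun n => hdecay.lintegral_enorm_iteratedFDeriv_sq_lt_top n⟩
  obtain ⟨⟨u, p, hsol⟩, -⟩ := h ν hν u₀ hdat
  obtain ⟨hns, hsu, hsp⟩ :=
    (isNavierStokesSolution_and_smooth_iff (ν := ν) (f := 0) (u₀ := u₀) (u := u) (p := p)).2
      ⟨hsol.isClassical, hsol.initial⟩
  refine ⟨u, p, hsu, hsp, hns, ?_⟩
  show HasBoundedEnergy u
  -- finite energy of the slices and the identity `∫⁻ ‖u t‖ₑ² = ofReal (∫ ‖u t‖²)` in the class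
  have key : ∀ S : ℝ, 0 < S → ∀ τ ∈ Icc (0:ℝ) S,
      ∫⁻ x, ‖u τ x‖ₑ ^ 2 = ENNReal.ofReal (∫ x, ‖u τ x‖ ^ 2) := by
    intro S hS τ hτ
    have hcl : IsClassicalNSSolutionOn (Icc 0 S) ν 0 u p :=
      hsol.isClassical.mono Icc_subset_Ici_self (uniqueDiffOn_Icc hS)
    obtain ⟨C, hC⟩ := hsol.sobolev S 0
    have hfin0 : ∫⁻ x, ‖iteratedFDeriv ℝ 0 (u τ) x‖ₑ ^ 2 < ⊤ := (hC τ hτ).trans_lt ENNReal.coe_lt_top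
    have heq : (fun x => ‖iteratedFDeriv ℝ 0 (u τ) x‖ₑ ^ 2) = fun x => ‖u τ x‖ₑ ^ 2 := by
      funext x
      rw [← ofReal_norm, norm_iteratedFDeriv_zero, ofReal_norm]
    have hfin : ∫⁻ x, ‖u τ x‖ₑ ^ 2 < ⊤ := by rwa [heq] at hfin0
    have hint : Integrable (fun x => ‖u τ x‖ ^ 2) :=
      integrable_sq_norm_of_lintegral_lt_top (hcl.contDiff_velocity hτ).continuous hfin
    rw [ofReal_integral_eq_lintegral_ofReal hint (Eventually.of_forall fun x => sq_nonneg _)]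
    refine lintegral_congr fun x => ?_
    rw [← ofReal_norm, ENNReal.ofReal_pow (norm_nonneg _)]
  refine ⟨∫⁻ x, ‖u₀ x‖ₑ ^ 2, ?_, fun t ht => ?_⟩
  · have h0 := hdat.2.2 0
    have heq : (fun x => ‖iteratedFDeriv ℝ 0 u₀ x‖ₑ ^ 2) = fun x => ‖u₀ x‖ₑ ^ 2 := by
      funext x
      rw [← ofReal_norm, norm_iteratedFDeriv_zero, ofReal_norm]
    rwa [heq] at h0
  · have hT : (0:ℝ) < t + 1 := by linarith
    have hcl : IsClassicalNSSolutionOn (Icc 0 (t + 1)) ν 0 u p :=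
      hsol.isClassical.mono Icc_subset_Ici_self (uniqueDiffOn_Icc hT)
    have hE : ∫ x, ‖u t x‖ ^ 2 ≤ ∫ x, ‖u 0 x‖ ^ 2 :=
      hcl.bkm_energy_le hν.le hT (hsol.sobolev (t + 1)) ⟨ht, by linarith⟩
    rw [key (t + 1) hT t ⟨ht, by linarith⟩, ← hsol.initial, key (t + 1) hT 0 ⟨le_rfl, hT.le⟩]
    exact ENNReal.ofReal_le_ofReal hE

/-- Theorem 1.1 (all `ν ≥ 0`) implies Clay (A) through its Navier–Stokes half.
[cite: FeffermanClay2006, statement (A), CMI offprint p. 2] -/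
theorem clay_of_claimed (h : ClaimedTheorem) : ClayVariants.clayR3.Regularity :=
  clay_of_claimedNS (claimedTheorem_iff.1 h).1

/-! ### D-0026 in-file discharges of the TRUE printed steps (append-only; Literature-side twins)

The steps below are kernel-true AS TYPED. Their proofs were first landed summit-side by the salvage lane
(`Summit.NavierStokesRegularity.NavierStokesRegularity.Theorems.Chae2007.step2_holds`, `step3_energy_holds`,
`step8_holds`, `step9_holds`, `step10_holds` in `Theorems/SoloSalvageChae2007.lean`, seat `ns-claims-salvage-p4`);
a Literature module cannot import `Summits`, so the facts `Step_2`, `Step_3`, `Step_8`, `Step_9`, `Step_10` are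
discharged HERE, where they are declared, by the same arguments (ported verbatim up to names). Nothing else in the
file is touched: the locator of record (`Step_5`, (1.11) p. 5, refuted summit-side by `…Theorems.Chae2007.not_Step_5`),
the class, the composition and the Clay link are unchanged; `Step_4`, `Step_6`, `Step_7`, `Step_11` stay undischarged
(rescaling bookkeeping / Gagliardo–Nirenberg (1.10), see the module docstring); `Step_1` (the local theory) is the
tree's BKM-class maximal-solution theorem (`step_1_holds`, last block). -/

/-- **Step 2 holds** — it IS, by name, the tree's discharged Beale–Kato–Majda a-priori `H³` bound
(`MajdaBertozzi2002_bkmAprioriH3_holds`, Majda–Bertozzi 2002, proof of Thm. 3.6). Twin of the summit-side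
`…Theorems.Chae2007.step2_holds`. [cite: MajdaBertozzi2002, Thm. 3.6 (p. 115) and its proof (pp. 116–117)] -/
theorem step_2_holds : Step_2 :=
  MajdaBertozzi2002_bkmAprioriH3_holds

/-- **Step 8 holds as printed** (p. 6, (1.17) and "then (1.12) is automatically satisfied, and `K < 1`"): for
`0 < γ`, `0 ≤ m < γ/5` one has `0 < 6γ/5 − m` and `γ/(6γ/5 − m) < 1` — correct arithmetic WITH THE PRINTED
CONSTANT (the sentence fails only for the honestly integrated constant `(5/6)c`, which is the refuter's locator at
`Step_5`, not this step's content). Twin of `…Theorems.Chae2007.step8_holds`.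
[cite: Chae2007GlobalRegularityWithdrawn, (1.16)–(1.17) p. 6] -/
theorem step_8_holds : Step_8 := by
  intro γ m hγ hm hmγ
  have hc : 0 < 6 * γ / 5 - m := by linarith
  refine ⟨hc, ?_⟩
  rw [div_lt_one hc]
  linarith

/-- **Step 10 holds** (p. 6, "substituting (1.18) into (1.14) we obtain (1.19)"): from `a ≤ c⁻¹ log y`,
`0 < y ≤ exp(c Z₀^{5/6} t)` and `c > 0` follows `a ≤ Z₀^{5/6} t` (monotonicity of `log`). Twin of
`…Theorems.Chae2007.step10_holds`. [cite: Chae2007GlobalRegularityWithdrawn, (1.19) p. 6] -/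
theorem step_10_holds : Step_10 := by
  intro c Z₀ a y t hc _hZ₀ hy ha hyexp
  have hlog : Real.log y ≤ c * Z₀ ^ ((5:ℝ) / 6) * t := by
    have := Real.log_le_log hy hyexp
    rwa [Real.log_exp] at this
  have hcinv : 0 ≤ c⁻¹ := inv_nonneg.mpr hc.le
  calc a ≤ c⁻¹ * Real.log y := ha
    _ ≤ c⁻¹ * (c * Z₀ ^ ((5:ℝ) / 6) * t) := mul_le_mul_of_nonneg_left hlog hcinv
    _ = Z₀ ^ ((5:ℝ) / 6) * t := by field_simp

/-- **Step 9 holds** (p. 6, (1.15) ⇒ (1.18), the abstract Grönwall grain as typed): a continuous `y ≥ 1` on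
`[0,T)` with `y(0) = 1` and right derivative `≤ M y^K`, `M ≥ 0`, `K < 1`, satisfies `y(t) ≤ e^{Mt}`. Proof:
`y^K ≤ y` for `y ≥ 1`, `K ≤ 1`, so the right derivative is `≤ M y`; fence `y` under `e^{(M+ε)t}` for every
`ε > 0` (Mathlib's `image_le_of_deriv_right_lt_deriv_boundary'`: strict inequality at touching points) and let
`ε → 0`. Twin of `…Theorems.Chae2007.step9_holds`. [cite: Chae2007GlobalRegularityWithdrawn, (1.15)–(1.18) p. 6] -/
theorem step_9_holds : Step_9 := by
  intro M K T hM hK hT y hy0 hcont hge hder t ht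
  -- right derivatives on `[0,T)`
  choose! D hD hDle using hder
  -- compare with `e^{(M+ε) s}` on `[0, t]` for every `ε > 0`
  have hfence : ∀ ε : ℝ, 0 < ε → y t ≤ Real.exp ((M + ε) * t) := by
    intro ε hε
    have hsub : Icc (0:ℝ) t ⊆ Ico 0 T := fun s hs => ⟨hs.1, hs.2.trans_lt ht.2⟩
    have hcont' : ContinuousOn y (Icc 0 t) := hcont.mono hsub
    have hder' : ∀ s ∈ Ico (0:ℝ) t, HasDerivWithinAt y (D s) (Ici s) s :=
      fun s hs => hD s ⟨hs.1, hs.2.trans ht.2⟩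
    have hB : ContinuousOn (fun s => Real.exp ((M + ε) * s)) (Icc 0 t) :=
      (Real.continuous_exp.comp (continuous_const.mul continuous_id)).continuousOn
    have hB' : ∀ s ∈ Ico (0:ℝ) t,
        HasDerivWithinAt (fun s => Real.exp ((M + ε) * s)) ((M + ε) * Real.exp ((M + ε) * s)) (Ici s) s := by
      intro s _
      have h1 : HasDerivAt (fun s => (M + ε) * s) (M + ε) s := by
        simpa using (hasDerivAt_id s).const_mul (M + ε)
      have h2 := h1.exp
      simpa [mul_comm] using h2.hasDerivWithinAt
    have h0 : y 0 ≤ Real.exp ((M + ε) * 0) := by simp [hy0]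
    have hbound : ∀ s ∈ Ico (0:ℝ) t, y s = Real.exp ((M + ε) * s) →
        D s < (M + ε) * Real.exp ((M + ε) * s) := by
      intro s hs heq
      have hs' : s ∈ Ico (0:ℝ) T := ⟨hs.1, hs.2.trans ht.2⟩
      have hy1 : 1 ≤ y s := hge s hs'
      have hypos : 0 < y s := lt_of_lt_of_le one_pos hy1
      have hrpow : y s ^ K ≤ y s := by
        calc y s ^ K ≤ y s ^ (1:ℝ) := Real.rpow_le_rpow_of_exponent_le hy1 hK.le
          _ = y s := Real.rpow_one _
      have h1 : D s ≤ M * y s := (hDle s hs').trans (mul_le_mul_of_nonneg_left hrpow hM)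
      have h2 : M * y s < (M + ε) * y s := by nlinarith
      rw [← heq]
      exact lt_of_le_of_lt h1 h2
    exact image_le_of_deriv_right_lt_deriv_boundary' hcont' hder' h0 hB hB' hbound
      (right_mem_Icc.2 ht.1)
  -- let `ε → 0⁺`
  have hlim : Tendsto (fun ε : ℝ => Real.exp ((M + ε) * t)) (𝓝[>] 0) (𝓝 (Real.exp ((M + 0) * t))) := by
    have hc : Continuous fun ε : ℝ => Real.exp ((M + ε) * t) := by fun_prop
    exact (hc.tendsto 0).mono_left nhdsWithin_le_nhds
  rw [add_zero] at hlim
  exact ge_of_tendsto hlim (eventually_nhdsWithin_of_forall fun ε hε => hfence ε hε)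

/-- `‖f‖_{L²}` of this file (the `lintegral` rendering) equals the square root of the Bochner integral `∫ ‖f‖²`
for a strongly measurable field — plumbing between `l2Norm` and the tree's Bochner-integral energy inequality.
[cite: Chae2007GlobalRegularityWithdrawn, §1 p. 1 (definition of the `L²` norm)] -/
private theorem l2Norm_eq_sqrt_integral_sq {f : EuclideanSpace ℝ (Fin 3) → EuclideanSpace ℝ (Fin 3)}
    (hf : AEStronglyMeasurable f volume) : l2Norm f = Real.sqrt (∫ x, ‖f x‖ ^ 2) := by
  unfold l2Norm
  have hm : AEStronglyMeasurable (fun x => ‖f x‖ ^ 2) volume :=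
    (continuous_pow 2).comp_aestronglyMeasurable hf.norm
  congr 1
  rw [integral_eq_lintegral_of_nonneg_ae (Eventually.of_forall fun x => by positivity) hm]
  congr 1
  refine lintegral_congr fun x => ?_
  rw [← ofReal_norm, ENNReal.ofReal_pow (norm_nonneg _)]

/-- **Step 3 holds** ((1.8) p. 4 in the original clock: `‖v(t)‖_{L²} ≤ ‖v₀‖_{L²}` on `[0,T)` for a classical
solution in the BKM class, every `ν ≥ 0`) — the tree's energy inequality in the BKM class
`IsClassicalNSSolutionOn.bkm_energy_le` (Majda–Bertozzi 2002, Prop. 3.1) on each `[0,t]`, `t < T`, transported to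
the `lintegral` rendering of `‖·‖_{L²}`. Twin of `…Theorems.Chae2007.step3_energy_holds`.
[cite: MajdaBertozzi2002, Prop. 3.1] -/
theorem step_3_holds : Step_3 := by
  intro ν hν T hT v₀ u p hsol t ht
  rcases eq_or_lt_of_le ht.1 with h0 | htpos
  · rw [← h0, hsol.initial]
  have hsub : Icc (0:ℝ) t ⊆ Ico 0 T := fun s hs => ⟨hs.1, hs.2.trans_lt ht.2⟩
  have hcl : IsClassicalNSSolutionOn (Icc 0 t) ν 0 u p :=
    hsol.isClassical.mono hsub (uniqueDiffOn_Icc htpos)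
  have hB : HasBoundedSobolevNormsOn (Icc 0 t) u := hsol.sobolev t ht.2
  have hE := hcl.bkm_energy_le hν htpos hB (right_mem_Icc.2 ht.1)
  rw [hsol.initial] at hE
  have hmeas : ∀ s ∈ Icc (0:ℝ) t, AEStronglyMeasurable (u s) volume :=
    fun s hs => (hcl.contDiff_velocity hs).continuous.aestronglyMeasurable
  rw [l2Norm_eq_sqrt_integral_sq (hmeas t (right_mem_Icc.2 ht.1)),
    l2Norm_eq_sqrt_integral_sq (by rw [← hsol.initial]; exact hmeas 0 (left_mem_Icc.2 ht.1))]
  exact Real.sqrt_le_sqrt hE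

/-- **Step 1 holds** (p. 2, the local theory the proof by contradiction starts from, citing Kato 1972:
"Let `T` be the maximal time of existence of a classical solution in `H³` … suppose `T < ∞`", rendered as
the dichotomy GLOBAL solution ∨ finite maximal time with `H³` blow-up, in the Beale–Kato–Majda class, every
`ν ≥ 0`, Euler included): this IS the tree's maximal-solution theorem in the BKM class,
`Literature.Analysis.FluidPDE.exists_global_bkmClass_or_blowup` (`NSVorticityBKMMaximal.lean`; assembled
from Majda–Bertozzi 2002 Thm. 3.4 / Cor. 3.1 / Cor. 3.2 / Thm. 3.6, all discharged in the tree), read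
through this file's renderings `IsGlobalSolution` / `IsLocalSolution` / `BlowsUpAt`.
[cite: MajdaBertozzi2002, Thm. 3.6 and §3.3 (pp. 115–117), Cor. 3.2 (p. 112)] -/
theorem step_1_holds : Step_1 := by
  intro ν hν v₀ hv₀
  obtain ⟨hsm, hdiv, hH⟩ := hv₀
  rcases exists_global_bkmClass_or_blowup hν hsm hdiv hH with
    ⟨u, p, hu, hu0, hB, -⟩ | ⟨T, hT, u, p, hu, hu0, hreg, hnb, -, -, -⟩
  · exact Or.inl ⟨u, p, ⟨hu, hu0, hB⟩⟩
  · exact Or.inr ⟨T, hT, u, p, ⟨hu, hu0, hreg⟩, hnb⟩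

/-! ### D-0026 in-file discharges of the clock bookkeeping, Steps 6 and 7 (pp. 5–6; append-only)

`Step_6` ((1.11) ⇒ (1.14) "transforming back to the original velocity") and `Step_7` ((1.14) ⇒ (1.15), with
the bookkeeping `y(0) = 1`, `y ≥ 1`, continuity, right derivative) are honest calculus ABOUT the clock
`s(t) = ∫₀ᵗ exp[γ a(τ)] dτ`, `a(t) = ∫₀ᵗ ‖D³v‖^{5/6}`, along a solution of the Beale–Kato–Majda class. The
only analytic input is that `τ ↦ ‖D³v(τ)‖_{L²}` is bounded and measurable on compact sub-intervals of
`[0, T)` (joint smoothness: `IsSmoothSpaceTimeOn.iteratedFDeriv_slice`; the `H³` bound of the class), so that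
`a` is continuous, `s` is `C¹` with `s′ = exp[γ a] > 0`, and the fundamental theorem of calculus applies to
`log y`. Nothing else in the file is touched; the locator `Step_5` ((1.11) p. 5) is unchanged. -/

/-- `Σ_{|α|=3}|D^α f(x)|² ≤ 27 ‖D³f(x)‖²`: each of the (at most 27) terms of `hd3Sq` is the square of a value
of the trilinear map `D³f(x)` on unit vectors. [folklore] -/
private theorem hd3Sq_le (f : EuclideanSpace ℝ (Fin 3) → EuclideanSpace ℝ (Fin 3))
    (x : EuclideanSpace ℝ (Fin 3)) : hd3Sq f x ≤ 27 * ‖iteratedFDeriv ℝ 3 f x‖ ^ 2 := by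
  have hb : ∀ i : Fin 3, ‖basisVec i‖ = 1 := fun i => by simp [basisVec]
  have hterm : ∀ i j k : Fin 3,
      (if i ≤ j ∧ j ≤ k then ‖iteratedFDeriv ℝ 3 f x ![basisVec i, basisVec j, basisVec k]‖ ^ 2 else 0) ≤
        ‖iteratedFDeriv ℝ 3 f x‖ ^ 2 := by
    intro i j k
    split_ifs
    · refine pow_le_pow_left₀ (norm_nonneg _) ?_ 2
      refine (ContinuousMultilinearMap.le_opNorm _ _).trans ?_
      have hprod : ∏ l : Fin 3, ‖(![basisVec i, basisVec j, basisVec k] : Fin 3 → EuclideanSpace ℝ (Fin 3)) l‖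
          = 1 := by
        simp [Fin.prod_univ_three, hb]
      rw [hprod, mul_one]
    · positivity
  unfold hd3Sq
  calc (∑ i : Fin 3, ∑ j : Fin 3, ∑ k : Fin 3,
        if i ≤ j ∧ j ≤ k then ‖iteratedFDeriv ℝ 3 f x ![basisVec i, basisVec j, basisVec k]‖ ^ 2 else 0)
      ≤ ∑ _i : Fin 3, ∑ _j : Fin 3, ∑ _k : Fin 3, ‖iteratedFDeriv ℝ 3 f x‖ ^ 2 :=
        Finset.sum_le_sum fun i _ => Finset.sum_le_sum fun j _ => Finset.sum_le_sum fun k _ => hterm i j k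
    _ = 27 * ‖iteratedFDeriv ℝ 3 f x‖ ^ 2 := by
        simp only [Finset.sum_const, Finset.card_univ, Fintype.card_fin]
        ring

/-- In the Beale–Kato–Majda class the `Ḣ³` seminorm of the slices is bounded on the time set:
`‖D³u(τ)‖_{L²} ≤ B` for `τ ∈ S` (from the order-3 bound of `HasBoundedSobolevNormsOn` and `hd3Sq_le`). [folklore] -/
private theorem exists_hd3Norm_le {S : Set ℝ}
    {u : ℝ → EuclideanSpace ℝ (Fin 3) → EuclideanSpace ℝ (Fin 3)} (hB : HasBoundedSobolevNormsOn S u) :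
    ∃ B : ℝ, 0 ≤ B ∧ ∀ τ ∈ S, hd3Norm (u τ) ≤ B := by
  obtain ⟨C, hC⟩ := hB 3
  refine ⟨Real.sqrt ((27 * (C : ℝ≥0∞)).toReal), Real.sqrt_nonneg _, fun τ hτ => ?_⟩
  unfold hd3Norm
  refine Real.sqrt_le_sqrt (ENNReal.toReal_mono (ENNReal.mul_ne_top (by simp) ENNReal.coe_ne_top) ?_)
  calc ∫⁻ x, ENNReal.ofReal (hd3Sq (u τ) x)
      ≤ ∫⁻ x, 27 * ‖iteratedFDeriv ℝ 3 (u τ) x‖ₑ ^ 2 := by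
        refine lintegral_mono fun x => ?_
        refine (ENNReal.ofReal_le_ofReal (hd3Sq_le (u τ) x)).trans_eq ?_
        rw [ENNReal.ofReal_mul (by norm_num : (0:ℝ) ≤ 27), ENNReal.ofReal_pow (norm_nonneg _), ofReal_norm,
          ENNReal.ofReal_ofNat]
    _ = 27 * ∫⁻ x, ‖iteratedFDeriv ℝ 3 (u τ) x‖ₑ ^ 2 := lintegral_const_mul' _ _ (by simp)
    _ ≤ 27 * (C : ℝ≥0∞) := by gcongr; exact hC τ hτ

/-- Measurability in time of `τ ↦ ‖D³u(τ)‖_{L²}` on `(0, t')`, `t' < T`, for a field jointly smooth on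
`[0, T) × ℝ³` (joint continuity of `(τ, x) ↦ D³u(τ)(x)`, `IsSmoothSpaceTimeOn.iteratedFDeriv_slice`, and
Tonelli). [folklore] -/
private theorem aemeasurable_hd3Norm {T t' : ℝ}
    {u : ℝ → EuclideanSpace ℝ (Fin 3) → EuclideanSpace ℝ (Fin 3)} (hu : IsSmoothSpaceTimeOn (Ico 0 T) u)
    (ht' : t' < T) :
    AEMeasurable (fun τ => hd3Norm (u τ)) ((volume : Measure ℝ).restrict (Ioo 0 t')) := by
  have hc3 : ContinuousOn
      (fun z : ℝ × EuclideanSpace ℝ (Fin 3) => iteratedFDeriv ℝ 3 (u z.1) z.2) (Icc 0 t' ×ˢ univ) :=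
    (hu.iteratedFDeriv_slice (uniqueDiffOn_Ico 0 T) 3).continuousOn.mono
      (prod_mono (Icc_subset_Ico_right ht') Subset.rfl)
  have hG : ContinuousOn (fun z : ℝ × EuclideanSpace ℝ (Fin 3) => hd3Sq (u z.1) z.2) (Icc 0 t' ×ˢ univ) := by
    unfold hd3Sq
    refine continuousOn_finsetSum _ fun i _ => continuousOn_finsetSum _ fun j _ =>
      continuousOn_finsetSum _ fun k _ => ?_
    by_cases hijk : i ≤ j ∧ j ≤ k
    · simp only [if_pos hijk]
      exact (((continuous_eval_const
        (![basisVec i, basisVec j, basisVec k] : Fin 3 → EuclideanSpace ℝ (Fin 3))).comp_continuousOn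
          hc3).norm).pow 2
    · simp only [if_neg hijk]
      exact continuousOn_const
  have hL : AEMeasurable (fun τ => ∫⁻ x, ENNReal.ofReal (hd3Sq (u τ) x))
      ((volume : Measure ℝ).restrict (Ioo 0 t')) :=
    (ENNReal.measurable_ofReal.comp_aemeasurable
      (aestronglyMeasurable_prod_of_continuousOn hG).aemeasurable).lintegral_prod_right'
  exact Real.continuous_sqrt.measurable.comp_aemeasurable hL.ennreal_toReal

/-- **The integrand of the exponent `a(t)` is locally integrable**: along a solution of the class on
`[0, T)`, `τ ↦ ‖D³v(τ)‖_{L²}^{5/6}` is interval-integrable on `[0, t']` for every `0 ≤ t' < T` (bounded and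
measurable there). [cite: Chae2007GlobalRegularityWithdrawn, (1.1)–(1.4) p.3] -/
theorem IsLocalSolution.intervalIntegrable_hd3Norm_rpow {ν T : ℝ}
    {v₀ : EuclideanSpace ℝ (Fin 3) → EuclideanSpace ℝ (Fin 3)}
    {u : ℝ → EuclideanSpace ℝ (Fin 3) → EuclideanSpace ℝ (Fin 3)} {p : ℝ → EuclideanSpace ℝ (Fin 3) → ℝ}
    (hsol : IsLocalSolution ν T v₀ u p) {t' : ℝ} (ht'0 : 0 ≤ t') (ht' : t' < T) :
    IntervalIntegrable (fun τ => hd3Norm (u τ) ^ ((5:ℝ) / 6)) volume 0 t' := by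
  obtain ⟨B, hB0, hB⟩ := exists_hd3Norm_le (hsol.sobolev t' ht')
  rw [intervalIntegrable_iff_integrableOn_Ioo_of_le ht'0]
  refine ⟨?_, HasFiniteIntegral.restrict_of_bounded (B ^ ((5:ℝ) / 6)) measure_Ioo_lt_top ?_⟩
  · exact ((aemeasurable_hd3Norm hsol.isClassical.smooth_velocity ht').pow_const _).aestronglyMeasurable
  · refine (ae_restrict_mem measurableSet_Ioo).mono fun τ hτ => ?_
    rw [Real.norm_eq_abs, abs_of_nonneg (Real.rpow_nonneg (hd3Norm_nonneg _) _)]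
    exact Real.rpow_le_rpow (hd3Norm_nonneg _) (hB τ ⟨hτ.1.le, hτ.2.le⟩) (by norm_num)

/-- The exponent `a(t) = ∫₀ᵗ ‖D³v‖^{5/6}` ((1.1)–(1.4) p. 3) is continuous on `[0, t']`, `t' < T`.
[cite: Chae2007GlobalRegularityWithdrawn, (1.1)–(1.4) p.3] -/
theorem IsLocalSolution.continuousOn_expo {ν T : ℝ}
    {v₀ : EuclideanSpace ℝ (Fin 3) → EuclideanSpace ℝ (Fin 3)}
    {u : ℝ → EuclideanSpace ℝ (Fin 3) → EuclideanSpace ℝ (Fin 3)} {p : ℝ → EuclideanSpace ℝ (Fin 3) → ℝ}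
    (hsol : IsLocalSolution ν T v₀ u p) {t' : ℝ} (ht'0 : 0 ≤ t') (ht' : t' < T) :
    ContinuousOn (expo u) (Icc 0 t') := by
  have h := intervalIntegral.continuousOn_primitive_interval' (hsol.intervalIntegrable_hd3Norm_rpow ht'0 ht')
    (left_mem_uIcc (a := (0:ℝ)) (b := t'))
  rw [uIcc_of_le ht'0] at h
  exact h

/-- The clock integrand `exp[γ a(τ)]` is continuous on `[0, t']`, `t' < T`. [cite: Chae2007GlobalRegularityWithdrawn, (1.4) p.3] -/
theorem IsLocalSolution.continuousOn_exp_expo {ν T : ℝ}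
    {v₀ : EuclideanSpace ℝ (Fin 3) → EuclideanSpace ℝ (Fin 3)}
    {u : ℝ → EuclideanSpace ℝ (Fin 3) → EuclideanSpace ℝ (Fin 3)} {p : ℝ → EuclideanSpace ℝ (Fin 3) → ℝ}
    (hsol : IsLocalSolution ν T v₀ u p) (γ : ℝ) {t' : ℝ} (ht'0 : 0 ≤ t') (ht' : t' < T) :
    ContinuousOn (fun τ => Real.exp (γ * expo u τ)) (Icc 0 t') :=
  (continuousOn_const.mul (hsol.continuousOn_expo ht'0 ht')).rexp

/-- **The clock is differentiable from the right with `s′(t) = exp[γ a(t)]`** on `[0, T)` ((1.4) p. 3: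
`ds = e^{γ a(t)} dt`; fundamental theorem of calculus for the continuous integrand).
[cite: Chae2007GlobalRegularityWithdrawn, (1.4) p.3] -/
theorem IsLocalSolution.hasDerivWithinAt_clock {ν T : ℝ}
    {v₀ : EuclideanSpace ℝ (Fin 3) → EuclideanSpace ℝ (Fin 3)}
    {u : ℝ → EuclideanSpace ℝ (Fin 3) → EuclideanSpace ℝ (Fin 3)} {p : ℝ → EuclideanSpace ℝ (Fin 3) → ℝ}
    (hsol : IsLocalSolution ν T v₀ u p) (γ : ℝ) {t : ℝ} (ht : t ∈ Ico 0 T) :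
    HasDerivWithinAt (clock γ u) (Real.exp (γ * expo u t)) (Ici t) t := by
  set t' : ℝ := (t + T) / 2 with ht'def
  have htt' : t < t' := by rw [ht'def]; linarith [ht.2]
  have ht'T : t' < T := by rw [ht'def]; linarith [ht.2]
  have ht'0 : 0 ≤ t' := ht.1.trans htt'.le
  have hg := hsol.continuousOn_exp_expo γ ht'0 ht'T
  have hsub : Ioo t t' ⊆ Icc 0 t' := fun s hs => ⟨ht.1.trans hs.1.le, hs.2.le⟩
  have hfi : IntervalIntegrable (fun τ => Real.exp (γ * expo u τ)) volume 0 t := by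
    refine (hg.mono ?_).intervalIntegrable
    rw [uIcc_of_le ht.1]
    exact Icc_subset_Icc_right htt'.le
  have hmeas : StronglyMeasurableAtFilter (fun τ => Real.exp (γ * expo u τ)) (𝓝[>] t) volume := by
    refine (hg.stronglyMeasurableAtFilter_nhdsWithin measurableSet_Icc t).filter_mono ?_
    rw [← nhdsWithin_Ioo_eq_nhdsGT htt']
    exact nhdsWithin_mono _ hsub
  have hcont : ContinuousWithinAt (fun τ => Real.exp (γ * expo u τ)) (Ioi t) t :=
    (hg t ⟨ht.1, htt'.le⟩).mono_of_mem_nhdsWithin (mem_of_superset (Ioo_mem_nhdsGT htt') hsub)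
  exact intervalIntegral.integral_hasDerivWithinAt_right hfi hmeas hcont

/-- The clock is nonnegative at nonnegative times (`exp > 0`). [cite: Chae2007GlobalRegularityWithdrawn, (1.4) p.3] -/
theorem clock_nonneg (γ : ℝ) (u : ℝ → EuclideanSpace ℝ (Fin 3) → EuclideanSpace ℝ (Fin 3)) {t : ℝ}
    (ht : 0 ≤ t) : 0 ≤ clock γ u t :=
  intervalIntegral.integral_nonneg ht fun _ _ => (Real.exp_pos _).le

/-- **The clock is strictly increasing on `[0, T)`** (its integrand is positive and continuous there).
[cite: Chae2007GlobalRegularityWithdrawn, (1.4) p.3] -/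
theorem IsLocalSolution.clock_lt_clock {ν T : ℝ}
    {v₀ : EuclideanSpace ℝ (Fin 3) → EuclideanSpace ℝ (Fin 3)}
    {u : ℝ → EuclideanSpace ℝ (Fin 3) → EuclideanSpace ℝ (Fin 3)} {p : ℝ → EuclideanSpace ℝ (Fin 3) → ℝ}
    (hsol : IsLocalSolution ν T v₀ u p) (γ : ℝ) {t t₁ : ℝ} (ht : 0 ≤ t) (htt₁ : t < t₁) (ht₁ : t₁ < T) :
    clock γ u t < clock γ u t₁ := by
  have hg := hsol.continuousOn_exp_expo γ (ht.trans htt₁.le) ht₁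
  have h0t : IntervalIntegrable (fun τ => Real.exp (γ * expo u τ)) volume 0 t := by
    refine (hg.mono ?_).intervalIntegrable
    rw [uIcc_of_le ht]
    exact Icc_subset_Icc_right htt₁.le
  have htt : IntervalIntegrable (fun τ => Real.exp (γ * expo u τ)) volume t t₁ := by
    refine (hg.mono ?_).intervalIntegrable
    rw [uIcc_of_le htt₁.le]
    exact Icc_subset_Icc_left ht
  have hpos : 0 < ∫ τ in t..t₁, Real.exp (γ * expo u τ) :=
    intervalIntegral.intervalIntegral_pos_of_pos_on htt (fun _ _ => Real.exp_pos _) htt₁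
  have hadd := intervalIntegral.integral_add_adjacent_intervals h0t htt
  unfold clock
  linarith

/-- The clock is continuous on `[0, T)`. [cite: Chae2007GlobalRegularityWithdrawn, (1.4) p.3] -/
theorem IsLocalSolution.continuousOn_clock {ν T : ℝ}
    {v₀ : EuclideanSpace ℝ (Fin 3) → EuclideanSpace ℝ (Fin 3)}
    {u : ℝ → EuclideanSpace ℝ (Fin 3) → EuclideanSpace ℝ (Fin 3)} {p : ℝ → EuclideanSpace ℝ (Fin 3) → ℝ}
    (hsol : IsLocalSolution ν T v₀ u p) (γ : ℝ) : ContinuousOn (clock γ u) (Ico 0 T) := by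
  intro t ht
  set t' : ℝ := (t + T) / 2 with ht'def
  have htt' : t < t' := by rw [ht'def]; linarith [ht.2]
  have ht'T : t' < T := by rw [ht'def]; linarith [ht.2]
  have ht'0 : 0 ≤ t' := ht.1.trans htt'.le
  have hg := hsol.continuousOn_exp_expo γ ht'0 ht'T
  have hprim := intervalIntegral.continuousOn_primitive_interval' (μ := volume)
    ((hg.mono (by rw [uIcc_of_le ht'0])).intervalIntegrable) (left_mem_uIcc (a := (0:ℝ)) (b := t'))
  rw [uIcc_of_le ht'0] at hprim
  have hmem : Icc 0 t' ∈ 𝓝[Ico 0 T] t :=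
    mem_of_superset (inter_mem_nhdsWithin (Ico 0 T) (Iio_mem_nhds htt'))
      fun s hs => ⟨hs.1.1, le_of_lt hs.2⟩
  exact (hprim t ⟨ht.1, htt'.le⟩).mono_of_mem_nhdsWithin hmem

/-- **Step 7 holds** (p. 6: the definition of `y`, (1.14) ⇒ (1.15) with `K = γ/c` (1.16), and the
bookkeeping `y(0) = 1`, `y ≥ 1`, continuity): `y(t) = 1 + c‖D³v₀‖^{5/6} s(t)` is continuous on `[0,T)`,
`≥ 1`, with right derivative `y′ = c‖D³v₀‖^{5/6} e^{γ a(t)}`, and (1.14) `a ≤ c⁻¹ log y` gives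
`e^{γ a} ≤ y^{γ/c}`. Calculus over the clock lemmas above. [cite: Chae2007GlobalRegularityWithdrawn, (1.14)–(1.16) p.6] -/
theorem step_7_holds : Step_7 := by
  intro γ c hγ hc ν hν T hT v₀ u p hsol h114
  have hk0 : 0 ≤ c * hd3Norm v₀ ^ ((5:ℝ) / 6) := mul_nonneg hc.le (Real.rpow_nonneg (hd3Norm_nonneg v₀) _)
  have hy1 : ∀ t ∈ Ico 0 T, 1 ≤ yFun γ c v₀ u t := fun t ht => by
    unfold yFun
    exact le_add_of_nonneg_right (mul_nonneg hk0 (clock_nonneg γ u ht.1))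
  refine ⟨?_, ?_, hy1, fun t ht => ?_⟩
  · simp [yFun, clock, intervalIntegral.integral_same]
  · unfold yFun
    exact continuousOn_const.add (continuousOn_const.mul (hsol.continuousOn_clock γ))
  · refine ⟨c * hd3Norm v₀ ^ ((5:ℝ) / 6) * Real.exp (γ * expo u t), ?_, ?_⟩
    · have h := ((hsol.hasDerivWithinAt_clock γ ht).const_mul (c * hd3Norm v₀ ^ ((5:ℝ) / 6))).const_add 1
      exact h
    · have hypos : 0 < yFun γ c v₀ u t := lt_of_lt_of_le one_pos (hy1 t ht)
      have hexp : Real.exp (γ * expo u t) ≤ yFun γ c v₀ u t ^ (γ / c) := by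
        rw [Real.rpow_def_of_pos hypos]
        refine Real.exp_le_exp.2 ?_
        calc γ * expo u t ≤ γ * (c⁻¹ * Real.log (yFun γ c v₀ u t)) :=
              mul_le_mul_of_nonneg_left (h114 t ht) hγ.le
          _ = Real.log (yFun γ c v₀ u t) * (γ / c) := by ring
      exact mul_le_mul_of_nonneg_left hexp hk0

/-- **Step 6 holds** (pp. 5–6: (1.11) on `[0, S)` ⇒ (1.13) ⇒ (1.14), "transforming back to the original
velocity using (1.1)–(1.4)"): at the clock time `s = s(t)` the bound (1.11) reads
`e^{−(6γ/5)a(t)}‖D³v(t)‖ ≤ ‖D³v₀‖ / y(t)^{6/5}`, so `‖D³v(t)‖^{5/6} ≤ ‖D³v₀‖^{5/6} e^{γ a(t)}/y(t) =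
c⁻¹ (log y)′(t)` — this is (1.13) — and integrating over `[0, t]` (fundamental theorem of calculus for the
`C¹` function `log y`, `y(0) = 1`) gives (1.14) `a(t) ≤ c⁻¹ log y(t)`.
[cite: Chae2007GlobalRegularityWithdrawn, (1.11)–(1.14) pp.5–6] -/
theorem step_6_holds : Step_6 := by
  intro γ c hγ hc ν hν T hT v₀ u p hsol Z hZ0 hZid hbd t ht
  -- abbreviations: `k = c Z₀^{5/6}`, `g = e^{γ a}`, `y = 1 + k s`
  have hZ₀ : 0 ≤ hd3Norm v₀ := hd3Norm_nonneg v₀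
  set k : ℝ := c * hd3Norm v₀ ^ ((5:ℝ) / 6) with hk
  have hk0 : 0 ≤ k := mul_nonneg hc.le (Real.rpow_nonneg hZ₀ _)
  have hy : ∀ τ, yFun γ c v₀ u τ = 1 + k * clock γ u τ := fun τ => rfl
  have hy1 : ∀ τ ∈ Ico 0 T, 1 ≤ yFun γ c v₀ u τ := fun τ hτ => by
    rw [hy]
    exact le_add_of_nonneg_right (mul_nonneg hk0 (clock_nonneg γ u hτ.1))
  have hypos : ∀ τ ∈ Ico 0 T, 0 < yFun γ c v₀ u τ := fun τ hτ => lt_of_lt_of_le one_pos (hy1 τ hτ)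
  -- (1.13): the pointwise inequality `c ‖D³v(τ)‖^{5/6} ≤ k e^{γ a(τ)} / y(τ)` on `[0, T)`
  have hpt : ∀ τ ∈ Ico 0 T,
      c * hd3Norm (u τ) ^ ((5:ℝ) / 6) ≤ k * Real.exp (γ * expo u τ) / yFun γ c v₀ u τ := by
    intro τ hτ
    set τ₁ : ℝ := (τ + T) / 2 with hτ₁def
    have hττ₁ : τ < τ₁ := by rw [hτ₁def]; linarith [hτ.2]
    have hτ₁T : τ₁ < T := by rw [hτ₁def]; linarith [hτ.2]
    have hs : clock γ u τ ∈ Ico 0 (clock γ u τ₁) :=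
      ⟨clock_nonneg γ u hτ.1, hsol.clock_lt_clock γ hτ.1 hττ₁ hτ₁T⟩
    have h1 := hbd τ₁ ⟨hτ.1.trans hττ₁.le, hτ₁T⟩ (clock γ u τ) hs
    rw [hZid τ hτ, hZ0] at h1
    -- `h1 : e^{-(6γ/5)a} N ≤ Z₀ / y^{6/5}`
    have hyτ := hypos τ hτ
    have hy65 : 0 < yFun γ c v₀ u τ ^ ((6:ℝ) / 5) := Real.rpow_pos_of_pos hyτ _
    set a : ℝ := 6 * γ / 5 * expo u τ with ha
    have hN : hd3Norm (u τ) ≤ Real.exp a * (hd3Norm v₀ / yFun γ c v₀ u τ ^ ((6:ℝ) / 5)) := by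
      have h2 := mul_le_mul_of_nonneg_left h1 (Real.exp_pos a).le
      have h3 : Real.exp a * hd3Rescaled γ u τ = hd3Norm (u τ) := by
        unfold hd3Rescaled
        rw [← mul_assoc, ← Real.exp_add, ha, show 6 * γ / 5 * expo u τ + -(6 * γ / 5) * expo u τ = 0 by ring,
          Real.exp_zero, one_mul]
      rw [h3] at h2
      exact h2
    have hN0 : 0 ≤ hd3Norm (u τ) := hd3Norm_nonneg _
    have h4 : hd3Norm (u τ) ^ ((5:ℝ) / 6) ≤
        (Real.exp a * (hd3Norm v₀ / yFun γ c v₀ u τ ^ ((6:ℝ) / 5))) ^ ((5:ℝ) / 6) :=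
      Real.rpow_le_rpow hN0 hN (by norm_num)
    have h5 : (Real.exp a * (hd3Norm v₀ / yFun γ c v₀ u τ ^ ((6:ℝ) / 5))) ^ ((5:ℝ) / 6) =
        Real.exp (γ * expo u τ) * (hd3Norm v₀ ^ ((5:ℝ) / 6) / yFun γ c v₀ u τ) := by
      rw [Real.mul_rpow (Real.exp_pos a).le (div_nonneg hZ₀ hy65.le), ← Real.exp_mul, ha,
        show 6 * γ / 5 * expo u τ * ((5:ℝ) / 6) = γ * expo u τ by ring,
        Real.div_rpow hZ₀ hy65.le, ← Real.rpow_mul hyτ.le,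
        show (6:ℝ) / 5 * ((5:ℝ) / 6) = 1 by norm_num, Real.rpow_one]
    rw [h5] at h4
    calc c * hd3Norm (u τ) ^ ((5:ℝ) / 6)
        ≤ c * (Real.exp (γ * expo u τ) * (hd3Norm v₀ ^ ((5:ℝ) / 6) / yFun γ c v₀ u τ)) :=
          mul_le_mul_of_nonneg_left h4 hc.le
      _ = k * Real.exp (γ * expo u τ) / yFun γ c v₀ u τ := by rw [hk]; ring
  -- integrate (1.13) over `[0, t]`: left side `c a(t)`, right side `log y(t) - log y(0) = log y(t)`
  have htI : Icc 0 t ⊆ Ico 0 T := fun s hs => ⟨hs.1, hs.2.trans_lt ht.2⟩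
  have hg : ContinuousOn (fun τ => Real.exp (γ * expo u τ)) (Icc 0 t) := hsol.continuousOn_exp_expo γ ht.1 ht.2
  have hycont : ContinuousOn (yFun γ c v₀ u) (Icc 0 t) := by
    refine continuousOn_const.add (continuousOn_const.mul ((hsol.continuousOn_clock γ).mono htI))
  have hlogcont : ContinuousOn (fun τ => Real.log (yFun γ c v₀ u τ)) (Icc 0 t) :=
    hycont.log fun τ hτ => (hypos τ (htI hτ)).ne'
  have hF : ContinuousOn (fun τ => k * Real.exp (γ * expo u τ) / yFun γ c v₀ u τ) (Icc 0 t) :=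
    (continuousOn_const.mul hg).div hycont fun τ hτ => (hypos τ (htI hτ)).ne'
  have hFi : IntervalIntegrable (fun τ => k * Real.exp (γ * expo u τ) / yFun γ c v₀ u τ) volume 0 t := by
    refine (hF.mono ?_).intervalIntegrable
    rw [uIcc_of_le ht.1]
  have hderiv : ∀ x ∈ Ioo 0 t, HasDerivWithinAt (fun τ => Real.log (yFun γ c v₀ u τ))
      (k * Real.exp (γ * expo u x) / yFun γ c v₀ u x) (Ioi x) x := by
    intro x hx
    have hxT : x ∈ Ico 0 T := ⟨hx.1.le, hx.2.trans ht.2⟩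
    have hyder : HasDerivWithinAt (yFun γ c v₀ u) (k * Real.exp (γ * expo u x)) (Ici x) x :=
      ((hsol.hasDerivWithinAt_clock γ hxT).const_mul k).const_add 1
    exact (hyder.log (hypos x hxT).ne').mono Ioi_subset_Ici_self
  have hFTC := intervalIntegral.integral_eq_sub_of_hasDeriv_right_of_le ht.1 hlogcont hderiv hFi
  have hy0 : yFun γ c v₀ u 0 = 1 := by simp [yFun, clock, intervalIntegral.integral_same]
  rw [hy0, Real.log_one, sub_zero] at hFTC
  have hhI : IntervalIntegrable (fun τ => c * hd3Norm (u τ) ^ ((5:ℝ) / 6)) volume 0 t :=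
    (hsol.intervalIntegrable_hd3Norm_rpow ht.1 ht.2).const_mul c
  have hmono := intervalIntegral.integral_mono_on ht.1 hhI hFi fun τ hτ => hpt τ (htI hτ)
  rw [hFTC, intervalIntegral.integral_const_mul] at hmono
  -- `hmono : c * a(t) ≤ log y(t)`
  have hexpo : expo u t = ∫ τ in (0:ℝ)..t, hd3Norm (u τ) ^ ((5:ℝ) / 6) := rfl
  rw [← hexpo] at hmono
  calc expo u t = c⁻¹ * (c * expo u t) := by field_simp
    _ ≤ c⁻¹ * Real.log (yFun γ c v₀ u t) := mul_le_mul_of_nonneg_left hmono (inv_nonneg.2 hc.le)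

/-! ### Step 11 — the final bound `∫₀ᵀ‖ω‖_∞ ≤ C‖v₀‖^{1/6}‖D³v₀‖^{5/6}T` (p. 7)

The printed argument: the Gagliardo–Nirenberg inequality (1.10) `‖∇v‖_∞ ≤ C‖v‖^{1/6}_{L²}‖D³v‖^{5/6}_{L²}`,
`|ω| ≤ 2|∇v|`, the energy bound (1.8) and (1.19) integrated in time. The tree supplies (1.10) as
`exists_norm_fderiv_le_gagliardoNirenberg_dim_three` (for the tensor norm `‖D³v(x)‖`); the glue below compares
the tensor norm with the multi-index sum `Σ_{|α|=3}|D^α v|²` of p. 1 (`‖D³v(x)‖² ≤ 729 Σ_{|α|=3}|D^α v(x)|²`,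
by expansion on the standard basis and the symmetry of `D³v(x)`), and performs the time integration by
exhausting `(0,T)` with `(0, T − T/(n+2))`. -/

/-- `∫ Σ_{|α|=3}|D^α f|² ≤ 27 ∫ ‖D³f‖²` (from `hd3Sq_le`). [folklore] -/
private theorem lintegral_hd3Sq_le (f : EuclideanSpace ℝ (Fin 3) → EuclideanSpace ℝ (Fin 3)) :
    ∫⁻ x, ENNReal.ofReal (hd3Sq f x) ≤ 27 * ∫⁻ x, ‖iteratedFDeriv ℝ 3 f x‖ₑ ^ 2 := by
  calc ∫⁻ x, ENNReal.ofReal (hd3Sq f x)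
      ≤ ∫⁻ x, 27 * ‖iteratedFDeriv ℝ 3 f x‖ₑ ^ 2 := by
        refine lintegral_mono fun x => ?_
        refine (ENNReal.ofReal_le_ofReal (hd3Sq_le f x)).trans_eq ?_
        rw [ENNReal.ofReal_mul (by norm_num : (0:ℝ) ≤ 27), ENNReal.ofReal_pow (norm_nonneg _), ofReal_norm,
          ENNReal.ofReal_ofNat]
    _ = 27 * ∫⁻ x, ‖iteratedFDeriv ℝ 3 f x‖ₑ ^ 2 := lintegral_const_mul' _ _ (by simp)

/-- Operator norm versus the entries on the standard basis, for a trilinear map on `ℝ³`: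
`‖M‖ ≤ Σ_{r : Fin 3 → Fin 3} ‖M(e_{r 0}, e_{r 1}, e_{r 2})‖` (expand each slot on the basis). [folklore] -/
private theorem opNorm_le_sum_norm_apply_basisVec {F : Type*} [NormedAddCommGroup F] [NormedSpace ℝ F]
    (M : ContinuousMultilinearMap ℝ (fun _ : Fin 3 => EuclideanSpace ℝ (Fin 3)) F) :
    ‖M‖ ≤ ∑ r : Fin 3 → Fin 3, ‖M fun l => basisVec (r l)‖ := by
  classical
  refine ContinuousMultilinearMap.opNorm_le_bound (Finset.sum_nonneg fun r _ => norm_nonneg _) fun m => ?_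
  have h1 : m = fun l => ∑ i : Fin 3, (m l) i • basisVec i := by
    funext l
    exact euclidean_eq_sum_smul_stdVec (m l)
  have hexp : M m = ∑ r : Fin 3 → Fin 3, (∏ l, (m l) (r l)) • M fun l => basisVec (r l) := by
    calc M m = M fun l => ∑ i : Fin 3, (m l) i • basisVec i := by rw [← h1]
      _ = ∑ r : Fin 3 → Fin 3, M fun l => (m l) (r l) • basisVec (r l) :=
          ContinuousMultilinearMap.map_sum M fun l i => (m l) i • basisVec i
      _ = ∑ r : Fin 3 → Fin 3, (∏ l, (m l) (r l)) • M fun l => basisVec (r l) :=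
          Finset.sum_congr rfl fun r _ => ContinuousMultilinearMap.map_smul_univ M _ _
  rw [hexp, Finset.sum_mul]
  refine (norm_sum_le _ _).trans (Finset.sum_le_sum fun r _ => ?_)
  rw [norm_smul, mul_comm]
  refine mul_le_mul_of_nonneg_left ?_ (norm_nonneg _)
  rw [norm_prod]
  exact Finset.prod_le_prod (fun l _ => norm_nonneg _) fun l _ => PiLp.norm_apply_le (m l) (r l)

/-- A sorted entry `|D³f(x)(eᵢ,eⱼ,eₖ)|²`, `i ≤ j ≤ k`, is one summand of `Σ_{|α|=3}|D^α f(x)|²`. [folklore] -/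
private theorem norm_apply_sorted_sq_le_hd3Sq (f : EuclideanSpace ℝ (Fin 3) → EuclideanSpace ℝ (Fin 3))
    (x : EuclideanSpace ℝ (Fin 3)) {i j k : Fin 3} (hij : i ≤ j) (hjk : j ≤ k) :
    ‖iteratedFDeriv ℝ 3 f x ![basisVec i, basisVec j, basisVec k]‖ ^ 2 ≤ hd3Sq f x := by
  have hnn : ∀ i' j' k' : Fin 3, 0 ≤ (if i' ≤ j' ∧ j' ≤ k' then
      ‖iteratedFDeriv ℝ 3 f x ![basisVec i', basisVec j', basisVec k']‖ ^ 2 else 0) :=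
    fun i' j' k' => by positivity
  calc ‖iteratedFDeriv ℝ 3 f x ![basisVec i, basisVec j, basisVec k]‖ ^ 2
      = (if i ≤ j ∧ j ≤ k then ‖iteratedFDeriv ℝ 3 f x ![basisVec i, basisVec j, basisVec k]‖ ^ 2 else 0) := by
        rw [if_pos ⟨hij, hjk⟩]
    _ ≤ ∑ k' : Fin 3, (if i ≤ j ∧ j ≤ k' then
          ‖iteratedFDeriv ℝ 3 f x ![basisVec i, basisVec j, basisVec k']‖ ^ 2 else 0) :=
        Finset.single_le_sum (f := fun k' => if i ≤ j ∧ j ≤ k' then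
          ‖iteratedFDeriv ℝ 3 f x ![basisVec i, basisVec j, basisVec k']‖ ^ 2 else 0)
          (fun k' _ => hnn i j k') (Finset.mem_univ k)
    _ ≤ ∑ j' : Fin 3, ∑ k' : Fin 3, (if i ≤ j' ∧ j' ≤ k' then
          ‖iteratedFDeriv ℝ 3 f x ![basisVec i, basisVec j', basisVec k']‖ ^ 2 else 0) :=
        Finset.single_le_sum (f := fun j' => ∑ k' : Fin 3, if i ≤ j' ∧ j' ≤ k' then
          ‖iteratedFDeriv ℝ 3 f x ![basisVec i, basisVec j', basisVec k']‖ ^ 2 else 0)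
          (fun j' _ => Finset.sum_nonneg fun k' _ => hnn i j' k') (Finset.mem_univ j)
    _ ≤ ∑ i' : Fin 3, ∑ j' : Fin 3, ∑ k' : Fin 3, (if i' ≤ j' ∧ j' ≤ k' then
          ‖iteratedFDeriv ℝ 3 f x ![basisVec i', basisVec j', basisVec k']‖ ^ 2 else 0) :=
        Finset.single_le_sum (f := fun i' => ∑ j' : Fin 3, ∑ k' : Fin 3, if i' ≤ j' ∧ j' ≤ k' then
          ‖iteratedFDeriv ℝ 3 f x ![basisVec i', basisVec j', basisVec k']‖ ^ 2 else 0)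
          (fun i' _ => Finset.sum_nonneg fun j' _ => Finset.sum_nonneg fun k' _ => hnn i' j' k')
          (Finset.mem_univ i)
    _ = hd3Sq f x := rfl

/-- **Tensor norm versus multi-index sum.** For a `C³` field on `ℝ³`,
`‖D³f(x)‖² ≤ 729 · Σ_{|α|=3}|D^α f(x)|²`: expansion on the standard basis
(`opNorm_le_sum_norm_apply_basisVec`), symmetry of `D³f(x)` (the tree's
`Calculus.iteratedFDeriv_comp_perm_of_contDiff`) to sort the three slots, and Cauchy–Schwarz over the `27`
index triples. [folklore] -/
private theorem norm_iteratedFDeriv_three_sq_le_hd3Sq {f : EuclideanSpace ℝ (Fin 3) → EuclideanSpace ℝ (Fin 3)}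
    (hf : ContDiff ℝ 3 f) (x : EuclideanSpace ℝ (Fin 3)) :
    ‖iteratedFDeriv ℝ 3 f x‖ ^ 2 ≤ 729 * hd3Sq f x := by
  classical
  -- each basis entry is bounded by the multi-index sum, after sorting the slots
  have hentry : ∀ r : Fin 3 → Fin 3, ‖iteratedFDeriv ℝ 3 f x fun l => basisVec (r l)‖ ^ 2 ≤ hd3Sq f x := by
    intro r
    have hmono : Monotone (r ∘ Tuple.sort r) := Tuple.monotone_sort r
    have hperm : (iteratedFDeriv ℝ 3 f x fun l => basisVec (r l)) =
        iteratedFDeriv ℝ 3 f x fun l => basisVec ((r ∘ Tuple.sort r) l) :=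
      (Literature.Analysis.Calculus.iteratedFDeriv_comp_perm_of_contDiff hf (m := 3) le_rfl x
        (fun l => basisVec (r l)) (Tuple.sort r)).symm
    have hvec : (fun l => basisVec ((r ∘ Tuple.sort r) l)) =
        ![basisVec ((r ∘ Tuple.sort r) 0), basisVec ((r ∘ Tuple.sort r) 1),
          basisVec ((r ∘ Tuple.sort r) 2)] := by
      funext l
      fin_cases l <;> rfl
    rw [hperm, hvec]
    exact norm_apply_sorted_sq_le_hd3Sq f x (hmono (by decide : (0 : Fin 3) ≤ 1))
      (hmono (by decide : (1 : Fin 3) ≤ 2))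
  have hcard : ((Finset.univ : Finset (Fin 3 → Fin 3)).card : ℝ) = 27 := by
    rw [Finset.card_univ, Fintype.card_fun, Fintype.card_fin]
    norm_num
  calc ‖iteratedFDeriv ℝ 3 f x‖ ^ 2
      ≤ (∑ r : Fin 3 → Fin 3, ‖iteratedFDeriv ℝ 3 f x fun l => basisVec (r l)‖) ^ 2 :=
        pow_le_pow_left₀ (norm_nonneg _) (opNorm_le_sum_norm_apply_basisVec _) 2
    _ ≤ (Finset.univ : Finset (Fin 3 → Fin 3)).card *
          ∑ r : Fin 3 → Fin 3, ‖iteratedFDeriv ℝ 3 f x fun l => basisVec (r l)‖ ^ 2 :=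
        sq_sum_le_card_mul_sum_sq
    _ ≤ 27 * ∑ _r : Fin 3 → Fin 3, hd3Sq f x := by
        rw [hcard]
        gcongr with r _
        exact hentry r
    _ = 729 * hd3Sq f x := by
        rw [Finset.sum_const, nsmul_eq_mul, hcard]
        ring

/-- `L²`-membership of a continuous field from a finite `∫⁻ ‖g‖ₑ²` (plumbing). [folklore] -/
private theorem memLp_two_of_lintegral_lt_top {G : Type*} [NormedAddCommGroup G]
    {g : EuclideanSpace ℝ (Fin 3) → G} (hg : Continuous g) (h : ∫⁻ x, ‖g x‖ₑ ^ 2 < ⊤) : MemLp g 2 volume :=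
  (memLp_two_iff_integrable_sq_norm hg.aestronglyMeasurable).2 (integrable_sq_norm_of_lintegral_lt_top hg h)

/-- `(∫‖D³f‖²)^{1/2} ≤ 27 ‖f‖_{Ḣ³}` for a `C³` field with `D³f ∈ L²` (integrate
`norm_iteratedFDeriv_three_sq_le_hd3Sq`). [folklore] -/
private theorem sqrt_integral_norm_iteratedFDeriv_three_sq_le
    {f : EuclideanSpace ℝ (Fin 3) → EuclideanSpace ℝ (Fin 3)} (hf : ContDiff ℝ 3 f)
    (hfin : ∫⁻ x, ‖iteratedFDeriv ℝ 3 f x‖ₑ ^ 2 < ⊤) :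
    Real.sqrt (∫ x, ‖iteratedFDeriv ℝ 3 f x‖ ^ 2) ≤ 27 * hd3Norm f := by
  have hcont : Continuous fun x => iteratedFDeriv ℝ 3 f x := hf.continuous_iteratedFDeriv le_rfl
  have hint : Integrable (fun x => ‖iteratedFDeriv ℝ 3 f x‖ ^ 2) :=
    integrable_sq_norm_of_lintegral_lt_top hcont hfin
  have h1 : ∫ x, ‖iteratedFDeriv ℝ 3 f x‖ ^ 2 =
      (∫⁻ x, ENNReal.ofReal (‖iteratedFDeriv ℝ 3 f x‖ ^ 2)).toReal :=
    integral_eq_lintegral_of_nonneg_ae (Eventually.of_forall fun x => sq_nonneg _) hint.aestronglyMeasurable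
  have hle : ∫⁻ x, ENNReal.ofReal (‖iteratedFDeriv ℝ 3 f x‖ ^ 2) ≤ 729 * ∫⁻ x, ENNReal.ofReal (hd3Sq f x) := by
    calc ∫⁻ x, ENNReal.ofReal (‖iteratedFDeriv ℝ 3 f x‖ ^ 2)
        ≤ ∫⁻ x, 729 * ENNReal.ofReal (hd3Sq f x) := by
          refine lintegral_mono fun x => ?_
          refine (ENNReal.ofReal_le_ofReal (norm_iteratedFDeriv_three_sq_le_hd3Sq hf x)).trans_eq ?_
          rw [ENNReal.ofReal_mul (by norm_num : (0:ℝ) ≤ 729), ENNReal.ofReal_ofNat]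
      _ = 729 * ∫⁻ x, ENNReal.ofReal (hd3Sq f x) := lintegral_const_mul' _ _ (by simp)
  have hfin' : ∫⁻ x, ENNReal.ofReal (hd3Sq f x) ≠ ⊤ :=
    ((lintegral_hd3Sq_le f).trans_lt (ENNReal.mul_lt_top (by simp) hfin)).ne
  have h2 : ∫ x, ‖iteratedFDeriv ℝ 3 f x‖ ^ 2 ≤ 729 * (∫⁻ x, ENNReal.ofReal (hd3Sq f x)).toReal := by
    rw [h1]
    refine (ENNReal.toReal_mono (ENNReal.mul_ne_top (by simp) hfin') hle).trans_eq ?_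
    rw [ENNReal.toReal_mul, ENNReal.toReal_ofNat]
  calc Real.sqrt (∫ x, ‖iteratedFDeriv ℝ 3 f x‖ ^ 2)
      ≤ Real.sqrt (729 * (∫⁻ x, ENNReal.ofReal (hd3Sq f x)).toReal) := Real.sqrt_le_sqrt h2
    _ = 27 * hd3Norm f := by
        rw [Real.sqrt_mul (by norm_num), show Real.sqrt 729 = 27 by
          rw [show (729:ℝ) = 27 ^ 2 by norm_num, Real.sqrt_sq (by norm_num)]]
        rfl

/-- **(1.10) for the vorticity** (p. 4 and p. 7, first display): there is an absolute constant `K` with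
`sup_x |ω(x)| ≤ K ‖v‖_{L²}^{1/6} ‖v‖_{Ḣ³}^{5/6}` for every `C³` field `v` on `ℝ³` with `v, ∇v, D²v, D³v ∈ L²`
— the tree's Gagliardo–Nirenberg inequality `exists_norm_fderiv_le_gagliardoNirenberg_dim_three`
(Nirenberg 1959) with `|ω| ≤ 4‖∇v‖` (`norm_curl_le_four_mul`), `(∫‖D³v‖²)^{1/2} ≤ 27‖v‖_{Ḣ³}` and
`27^{5/6} ≤ 27`. [cite: Chae2007GlobalRegularityWithdrawn, (1.10) p.4] -/
theorem exists_norm_curl_le_l2Norm_rpow_mul_hd3Norm_rpow :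
    ∃ K : ℝ, 0 ≤ K ∧ ∀ f : EuclideanSpace ℝ (Fin 3) → EuclideanSpace ℝ (Fin 3), ContDiff ℝ 3 f →
      (∀ n : ℕ, n ≤ 3 → ∫⁻ x, ‖iteratedFDeriv ℝ n f x‖ₑ ^ 2 < ⊤) →
      ∀ x, ‖curl f x‖ ≤ K * l2Norm f ^ ((1:ℝ) / 6) * hd3Norm f ^ ((5:ℝ) / 6) := by
  obtain ⟨C, hC0, hC⟩ := exists_norm_fderiv_le_gagliardoNirenberg_dim_three
    (E := EuclideanSpace ℝ (Fin 3)) (F' := EuclideanSpace ℝ (Fin 3)) finrank_euclideanSpace_fin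
  refine ⟨108 * C, by positivity, fun f hf hH x => ?_⟩
  have hD : ∀ n : ℕ, n ≤ 3 → MemLp (fun x => iteratedFDeriv ℝ n f x) 2 volume := fun n hn =>
    memLp_two_of_lintegral_lt_top (hf.continuous_iteratedFDeriv (by exact_mod_cast hn)) (hH n hn)
  have hm0 : MemLp f 2 volume := by
    have h := hH 0 (by norm_num)
    have heq : (fun x => ‖iteratedFDeriv ℝ 0 f x‖ₑ ^ 2) = fun x => ‖f x‖ₑ ^ 2 := by
      funext x
      rw [← ofReal_norm, norm_iteratedFDeriv_zero, ofReal_norm]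
    rw [heq] at h
    exact memLp_two_of_lintegral_lt_top hf.continuous h
  have hm1 : MemLp (fun x => fderiv ℝ f x) 2 volume := by
    have h := hH 1 (by norm_num)
    have heq : (fun x => ‖iteratedFDeriv ℝ 1 f x‖ₑ ^ 2) = fun x => ‖fderiv ℝ f x‖ₑ ^ 2 := by
      funext x
      rw [← ofReal_norm, norm_iteratedFDeriv_one, ofReal_norm]
    rw [heq] at h
    exact memLp_two_of_lintegral_lt_top (hf.continuous_fderiv (by norm_num)) h
  have hGN := hC f hf hm0 hm1 (hD 2 (by norm_num)) (hD 3 le_rfl) x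
  have hl2 : Real.sqrt (∫ y, ‖f y‖ ^ 2) = l2Norm f :=
    (l2Norm_eq_sqrt_integral_sq hf.continuous.aestronglyMeasurable).symm
  have hB : 0 ≤ hd3Norm f := hd3Norm_nonneg f
  have h56 : (Real.sqrt (∫ y, ‖iteratedFDeriv ℝ 3 f y‖ ^ 2)) ^ ((5:ℝ) / 6) ≤ 27 * hd3Norm f ^ ((5:ℝ) / 6) := by
    calc (Real.sqrt (∫ y, ‖iteratedFDeriv ℝ 3 f y‖ ^ 2)) ^ ((5:ℝ) / 6)
        ≤ (27 * hd3Norm f) ^ ((5:ℝ) / 6) :=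
          Real.rpow_le_rpow (Real.sqrt_nonneg _)
            (sqrt_integral_norm_iteratedFDeriv_three_sq_le hf (hH 3 le_rfl)) (by norm_num)
      _ = (27:ℝ) ^ ((5:ℝ) / 6) * hd3Norm f ^ ((5:ℝ) / 6) := Real.mul_rpow (by norm_num) hB
      _ ≤ 27 * hd3Norm f ^ ((5:ℝ) / 6) :=
          mul_le_mul_of_nonneg_right (Real.rpow_le_self_of_one_le (by norm_num) (by norm_num))
            (Real.rpow_nonneg hB _)
  have h1 : ‖fderiv ℝ f x‖ ≤ C * l2Norm f ^ ((1:ℝ) / 6) * (27 * hd3Norm f ^ ((5:ℝ) / 6)) := by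
    rw [← hl2]
    exact hGN.trans (mul_le_mul_of_nonneg_left h56 (mul_nonneg hC0 (Real.rpow_nonneg (Real.sqrt_nonneg _) _)))
  calc ‖curl f x‖ ≤ 4 * ‖fderiv ℝ f x‖ := norm_curl_le_four_mul f x
    _ ≤ 4 * (C * l2Norm f ^ ((1:ℝ) / 6) * (27 * hd3Norm f ^ ((5:ℝ) / 6))) :=
        mul_le_mul_of_nonneg_left h1 (by norm_num)
    _ = 108 * C * l2Norm f ^ ((1:ℝ) / 6) * hd3Norm f ^ ((5:ℝ) / 6) := by ring

/-- **Time integration against (1.19)** (p. 7): along a solution of the class on `[0,T)`, if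
`a(t) = ∫₀ᵗ‖D³v(σ)‖^{5/6}dσ ≤ Z t` on `[0,T)` (`Z ≥ 0`), then `∫_{(0,T)} ‖D³v(t)‖^{5/6}_{L²} dt ≤ Z T` as a lower
Lebesgue integral — exhaust `(0,T)` by `(0, T − T/(n+2))`, on each of which the integrand is integrable
(`intervalIntegrable_hd3Norm_rpow`) and the integral is `a(T − T/(n+2))`.
[cite: Chae2007GlobalRegularityWithdrawn, (1.19) p.6 and p.7] -/
theorem IsLocalSolution.lintegral_hd3Norm_rpow_le {ν T : ℝ}
    {v₀ : EuclideanSpace ℝ (Fin 3) → EuclideanSpace ℝ (Fin 3)}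
    {u : ℝ → EuclideanSpace ℝ (Fin 3) → EuclideanSpace ℝ (Fin 3)} {p : ℝ → EuclideanSpace ℝ (Fin 3) → ℝ}
    (hsol : IsLocalSolution ν T v₀ u p) (hT : 0 < T) {Z : ℝ} (hZ : 0 ≤ Z)
    (h19 : ∀ t ∈ Ico 0 T, expo u t ≤ Z * t) :
    (∫⁻ t in Ioo 0 T, ENNReal.ofReal (hd3Norm (u t) ^ ((5:ℝ) / 6))) ≤ ENNReal.ofReal (Z * T) := by
  -- the exhaustion `(0,T) = ⋃ₙ (0, T − T/(n+2))`
  have htn : ∀ n : ℕ, 0 < T - T / (n + 2) ∧ T - T / (n + 2) < T := fun n => by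
    have hn : (0:ℝ) < n + 2 := by positivity
    have h1 : T / (n + 2) < T := by
      rw [div_lt_iff₀ hn]
      nlinarith
    have h2 : 0 < T / (n + 2) := div_pos hT hn
    constructor <;> linarith
  have hmono : Monotone fun n : ℕ => Ioo (0:ℝ) (T - T / (n + 2)) := by
    intro m n hmn
    refine Ioo_subset_Ioo le_rfl ?_
    have hm2 : (0:ℝ) < m + 2 := by positivity
    have hmn' : (m:ℝ) + 2 ≤ n + 2 := by
      have : (m:ℝ) ≤ n := Nat.cast_le.2 hmn
      linarith
    have : T / (n + 2) ≤ T / (m + 2) := div_le_div_of_nonneg_left hT.le hm2 hmn'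
    linarith
  have hU : (⋃ n : ℕ, Ioo (0:ℝ) (T - T / (n + 2))) = Ioo 0 T := by
    apply Subset.antisymm
    · exact iUnion_subset fun n => Ioo_subset_Ioo le_rfl (htn n).2.le
    · intro t ht
      obtain ⟨n, hn⟩ := exists_nat_gt (T / (T - t))
      have hTt : 0 < T - t := by linarith [ht.2]
      have h1 : T < n * (T - t) := (div_lt_iff₀ hTt).1 hn
      have h2 : T / (n + 2) < T - t := by
        rw [div_lt_iff₀ (by positivity : (0:ℝ) < n + 2)]
        nlinarith
      exact mem_iUnion.2 ⟨n, ht.1, by linarith⟩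
  rw [← hU, setLIntegral_iUnion_of_directed _ hmono.directed_le]
  refine iSup_le fun n => ?_
  -- on `(0, tₙ)` the integral is `ofReal (a(tₙ)) ≤ ofReal (Z tₙ) ≤ ofReal (Z T)`
  obtain ⟨htn0, htnT⟩ := htn n
  have hint : IntegrableOn (fun τ => hd3Norm (u τ) ^ ((5:ℝ) / 6)) (Ioo 0 (T - T / (n + 2))) volume :=
    (intervalIntegrable_iff_integrableOn_Ioo_of_le htn0.le).1
      (hsol.intervalIntegrable_hd3Norm_rpow htn0.le htnT)
  have heq : ENNReal.ofReal (expo u (T - T / (n + 2))) =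
      ∫⁻ t in Ioo 0 (T - T / (n + 2)), ENNReal.ofReal (hd3Norm (u t) ^ ((5:ℝ) / 6)) := by
    unfold expo
    rw [intervalIntegral.integral_of_le htn0.le, integral_Ioc_eq_integral_Ioo,
      ofReal_integral_eq_lintegral_ofReal hint
        (Eventually.of_forall fun τ => Real.rpow_nonneg (hd3Norm_nonneg _) _)]
  rw [← heq]
  refine ENNReal.ofReal_le_ofReal ((h19 _ ⟨htn0.le, htnT⟩).trans ?_)
  exact mul_le_mul_of_nonneg_left htnT.le hZ

/-- **Step 11 holds** (p. 7): along a solution of the class on `[0,T)` satisfying the energy bound (1.8)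
and (1.19), `∫₀ᵀ‖ω(t)‖_{L^∞}dt ≤ C‖v₀‖_{L²}^{1/6}‖D³v₀‖_{L²}^{5/6}T` with an absolute constant `C`, every
`ν ≥ 0`: pointwise in time `sup_x|ω(x,t)| ≤ K‖v(t)‖^{1/6}‖D³v(t)‖^{5/6} ≤ K‖v₀‖^{1/6}‖D³v(t)‖^{5/6}`
(`exists_norm_curl_le_l2Norm_rpow_mul_hd3Norm_rpow`, (1.8)), then the time integration against (1.19)
(`IsLocalSolution.lintegral_hd3Norm_rpow_le`); `C := K + 1`.
[cite: Chae2007GlobalRegularityWithdrawn, p.7] -/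
theorem step_11_holds : Step_11 := by
  obtain ⟨K, hK0, hK⟩ := exists_norm_curl_le_l2Norm_rpow_mul_hd3Norm_rpow
  refine ⟨K + 1, by linarith, fun ν _hν T hT v₀ u p hsol h18 h19 => ?_⟩
  have hL0 : 0 ≤ l2Norm v₀ := l2Norm_nonneg _
  have hZ0 : 0 ≤ hd3Norm v₀ ^ ((5:ℝ) / 6) := Real.rpow_nonneg (hd3Norm_nonneg _) _
  have hA0 : 0 ≤ K * l2Norm v₀ ^ ((1:ℝ) / 6) := mul_nonneg hK0 (Real.rpow_nonneg hL0 _)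
  -- pointwise in time: `sup_x |ω(x,t)| ≤ K‖v₀‖^{1/6} ‖D³v(t)‖^{5/6}` on `(0,T)`
  have hpt : ∀ t ∈ Ioo 0 T, (⨆ x, ‖curl (u t) x‖ₑ) ≤
      ENNReal.ofReal (K * l2Norm v₀ ^ ((1:ℝ) / 6)) * ENNReal.ofReal (hd3Norm (u t) ^ ((5:ℝ) / 6)) := by
    intro t ht
    have ht' : t ∈ Ico 0 T := ⟨ht.1.le, ht.2⟩
    have hcd : ContDiff ℝ 3 (u t) := (hsol.isClassical.contDiff_velocity ht').of_le (by norm_cast)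
    have hfin : ∀ n : ℕ, n ≤ 3 → ∫⁻ x, ‖iteratedFDeriv ℝ n (u t) x‖ₑ ^ 2 < ⊤ := by
      intro n _
      have hT'' : (t + T) / 2 < T := by linarith [ht.2]
      obtain ⟨C, hC⟩ := hsol.sobolev ((t + T) / 2) hT'' n
      exact (hC t ⟨ht.1.le, by linarith [ht.2]⟩).trans_lt ENNReal.coe_lt_top
    have h5 : 0 ≤ hd3Norm (u t) ^ ((5:ℝ) / 6) := Real.rpow_nonneg (hd3Norm_nonneg _) _
    have h16 : l2Norm (u t) ^ ((1:ℝ) / 6) ≤ l2Norm v₀ ^ ((1:ℝ) / 6) :=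
      Real.rpow_le_rpow (l2Norm_nonneg _) (h18 t ht') (by norm_num)
    have hω : ∀ x, ‖curl (u t) x‖ ≤ K * l2Norm v₀ ^ ((1:ℝ) / 6) * hd3Norm (u t) ^ ((5:ℝ) / 6) := fun x =>
      (hK (u t) hcd hfin x).trans (mul_le_mul_of_nonneg_right (mul_le_mul_of_nonneg_left h16 hK0) h5)
    rw [← ENNReal.ofReal_mul hA0]
    refine iSup_le fun x => ?_
    rw [← ofReal_norm]
    exact ENNReal.ofReal_le_ofReal (hω x)
  -- integrate in time over `(0,T)`
  calc (∫⁻ t in Ioo 0 T, ⨆ x, ‖curl (u t) x‖ₑ)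
      ≤ ∫⁻ t in Ioo 0 T, ENNReal.ofReal (K * l2Norm v₀ ^ ((1:ℝ) / 6)) *
          ENNReal.ofReal (hd3Norm (u t) ^ ((5:ℝ) / 6)) :=
        setLIntegral_mono' measurableSet_Ioo fun t ht => hpt t ht
    _ = ENNReal.ofReal (K * l2Norm v₀ ^ ((1:ℝ) / 6)) *
          ∫⁻ t in Ioo 0 T, ENNReal.ofReal (hd3Norm (u t) ^ ((5:ℝ) / 6)) :=
        lintegral_const_mul' _ _ ENNReal.ofReal_ne_top
    _ ≤ ENNReal.ofReal (K * l2Norm v₀ ^ ((1:ℝ) / 6)) * ENNReal.ofReal (hd3Norm v₀ ^ ((5:ℝ) / 6) * T) := by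
        gcongr
        exact hsol.lintegral_hd3Norm_rpow_le hT hZ0 h19
    _ = ENNReal.ofReal (K * l2Norm v₀ ^ ((1:ℝ) / 6) * (hd3Norm v₀ ^ ((5:ℝ) / 6) * T)) :=
        (ENNReal.ofReal_mul hA0).symm
    _ ≤ ENNReal.ofReal ((K + 1) * l2Norm v₀ ^ ((1:ℝ) / 6) * hd3Norm v₀ ^ ((5:ℝ) / 6) * T) := by
        refine ENNReal.ofReal_le_ofReal ?_
        have hP : 0 ≤ l2Norm v₀ ^ ((1:ℝ) / 6) * (hd3Norm v₀ ^ ((5:ℝ) / 6) * T) :=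
          mul_nonneg (Real.rpow_nonneg hL0 _) (mul_nonneg hZ0 hT.le)
        have hring : (K + 1) * l2Norm v₀ ^ ((1:ℝ) / 6) * hd3Norm v₀ ^ ((5:ℝ) / 6) * T
            = K * l2Norm v₀ ^ ((1:ℝ) / 6) * (hd3Norm v₀ ^ ((5:ℝ) / 6) * T)
              + l2Norm v₀ ^ ((1:ℝ) / 6) * (hd3Norm v₀ ^ ((5:ℝ) / 6) * T) := by ring
        rw [hring]
        linarith

end Literature.Claims.NS.Chae2007

end

-- WHAT THIS IS NOT: not a claim about NS regularity or blow-up; not a claim about any author beyond the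
-- typed locator.
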